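import Mathlib.Analysis.InnerProductSpace.PiL2
import Mathlib.Analysis.InnerProductSpace.GramMatrix
import Mathlib.Analysis.Convex.Extreme
import Mathlib.LinearAlgebra.Matrix.PosDef
import Mathlib.Analysis.Matrix.Order
import Mathlib.LinearAlgebra.Matrix.Rank
import Mathlib.Analysis.Convex.Combination
import Mathlib.Analysis.CStarAlgebra.ContinuousFunctionalCalculus.Commute
import HarnessLib

/-!
# Tsirelson's rigidity theorems for extremal quantum correlations (TS87, as restated in PSVW §8)

Source. B. S. Tsirel'son, *Quantum analogues of the Bell inequalities. The case of two spatially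
separated domains*, J. Soviet Math. 36 (1987) 557–570 [Tsirelson1987] ("TS87"), as RESTATED,
verbatim and without proof, in A. Prakash, J. Sikora, A. Varvitsiotis, Z. Wei, *Completely positive
semidefinite rank*, Math. Program. 171 (2018) = arXiv:1604.07199 [PrakashEtAl2017], §8 "Proof of
Theorem 11" (held text `paper:arxiv-1604.07199`, p24): Definition 5 (`C`-systems), Lemma 12 and
Theorem 20. TS87 itself is not held; the Lean statements follow PSVW's wording (secondary source,
cited together with the original).

These two results are exactly the external input of PSVW Theorem 11 (`PrakashEtAl2017_thm11` in
`CompletelyPsdRank.lean`): see `PrakashEtAl2017_thm11_of_tsirelson`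
(`QuantumCorrelationDimensionBound.lean`), which PROVES Theorem 11 from the two named facts below,
the Clifford dimension bound (`Literature.LinearAlgebra.two_pow_dvd_of_anticommutator_eq_gram`)
and PSVW's compression argument.

Contents: `quantumCorrelations n m` (the set `Cor(n,m)` in Tsirelson's unit-vector form, PSVW
Thm. 10 (iii) — the set written inline in `PrakashEtAl2017_thm11`), `IsCSystem` (PSVW Def. 5),
NAMED FACTS `Tsirelson1987_lemma12` (PSVW Lemma 12) and `Tsirelson1987_thm20` (PSVW Theorem 20).
Typing choices: real vectors of a `C`-system live in `ℝ^N` for an arbitrary `N` (every finite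
family spans a finite-dimensional space); "Hermitian operators in `H^d`" are Hermitian matrices over
an arbitrary finite index type `σ` (`d = |σ|`); "eigenvalues in `[−1,1]`" is `−I ⪯ A ⪯ I`; a density
matrix is a psd matrix of trace one; an orthogonal projector is a Hermitian idempotent. NOT here:
the remaining clauses of PSVW Lemma 12's paragraph ("we can find `C`-systems that lie in `ℝ^{τ_C}`",
"`rank(C) ≤ τ_C`"), which PSVW derive and which are re-derived where used.

**Lemma 12 is PROVED here** (`Tsirelson1987_lemma12_holds`, section `Lemma12Proof`, an elementary
argument not taken from [TS87]): (a) padding — a `C`-system of sub-unit vectors in any `ℝ^N` shows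
`C ∈ Cor(n,m)` (`mem_quantumCorrelations_of_isCSystem`: `Gram + diag(1 − ‖·‖²)` is psd with unit
diagonal, hence a Gram matrix of unit vectors in `ℝ^{n+m}`); (b) an extreme point of `Cor(n,m)` has no
zero row (`exists_apply_ne_zero_of_mem_extremePoints`) and `Cor`, `ext Cor` are transposition
invariant; (c) rigidity (`mem_span_of_isCSystem`): if `u_x ∉ span{v_y}`, its projection `w` onto that
span has `‖w‖ < 1` and reproduces row `x`, and the systems with `u_x ↦ (1 ± ε) w` exhibit `C` as a
midpoint of two distinct points of `Cor` — so `span{u_x} = span{v_y}` for every `C`-system; (d) then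
`rank C = dim span{v_y}` (`rank_eq_finrank_span_of_isCSystem`: `C = Uᵀ V` with `ker Uᵀ V = ker V`),
so `τ_C = rank C ≥ 1`.

**Theorem 20 is PROVED here as well** (`Tsirelson1987_thm20_holds`, section `Thm20Proof`, again an
elementary argument not taken from [TS87]; see the section docstring for the architecture: Gram
rigidity and a Li–Tam-type quadratic rigidity of `C`-systems of an extreme `C` on the convex side;
pure components of `ρ`, cyclicity of the support under the `B`-algebra and the transfer of vector
identities to operator identities on the operator side). Both named facts of this file are thus
theorems; `PrakashEtAl2017_thm11/16` and Result 1 follow unconditionally through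
`QuantumCorrelationDimensionBound.lean` (`…_of_thm20` corollaries applied to this theorem).
Appended: `finrank_span_eq_rank_of_mem_extremePoints` (`τ_C = rank C` for every `C`-system of an
extreme `C`, the value used in the proof of Lemma 12; = GdLL 2017 Lemma 3.2 (ii)). Second append:
`mem_quantumCorrelations_of_commutingRep` (PSVW Theorem 10 (i)⇒(iii) in commuting-operator form =
GdLL Theorem 4.1 (4)⇒(1): commuting operator representations give points of `Cor(n,m)`) and the public
padding lemma `IsCSystem.mem_quantumCorrelations`.
-/

noncomputable section

open Matrix
open scoped ComplexOrder

namespace Literature.Combinatorics.Optimization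


/-- The set `Cor(n,m)` of **quantum correlations** in Tsirelson's vector form (PSVW Theorem 10 (iii),
p17: "there exist unit vectors `{u_x}_x` and `{v_y}_y` in `ℝ^{n+m}` such that `c_{xy} = ⟨u_x, v_y⟩`"),
the set written out in the hypothesis of `PrakashEtAl2017_thm11`.
[cite: PrakashEtAl2017, Thm. 10 (iii) (p17)] -/
def quantumCorrelations (n m : ℕ) : Set (Matrix (Fin n) (Fin m) ℝ) :=
  {C | ∃ (u : Fin n → EuclideanSpace ℝ (Fin (n + m))) (v : Fin m → EuclideanSpace ℝ (Fin (n + m))),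
    (∀ x, ‖u x‖ = 1) ∧ (∀ y, ‖v y‖ = 1) ∧ ∀ x y, C x y = inner ℝ (u x) (v y)}

/-- **PSVW Definition 5** (p24, verbatim): "Given `C = (c_{xy}) ∈ Cor(n,m)`, we say that a family of
real vectors `{u_x, v_y}_{x,y}` forms a `C`-system if they satisfy `‖u_x‖ ≤ 1 ∀x`, `‖v_y‖ ≤ 1 ∀y`, and
`c_{xy} = ⟨u_x, v_y⟩ ∀ x,y`." Typed for vectors in `ℝ^N` (any `N`).
[cite: PrakashEtAl2017, Def. 5 (p24)] -/
def IsCSystem {n m N : ℕ} (C : Matrix (Fin n) (Fin m) ℝ) (u : Fin n → EuclideanSpace ℝ (Fin N))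
    (v : Fin m → EuclideanSpace ℝ (Fin N)) : Prop :=
  (∀ x, ‖u x‖ ≤ 1) ∧ (∀ y, ‖v y‖ ≤ 1) ∧ ∀ x y, C x y = inner ℝ (u x) (v y)

/-- **Tsirelson's rigidity lemma** (PSVW Lemma 12, p24, verbatim, attributed to [TS87] = B. S.
Tsirel'son, *Quantum analogues of the Bell inequalities. The case of two spatially separated
domains*, J. Soviet Math. 36 (1987) 557–570): "Let `C ∈ ext(Cor(n,m))`. Then, for any `C`-system of
vectors `{u_x, v_y}_{x,y}` we have that `span({u_x}_x) = span({v_y}_y)`. Furthermore, there exists an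
integer `τ_C ≥ 1`, depending only on `C`, such that for any `C`-system of vectors `{u_x, v_y}_{x,y}`
we have that `dim(span({u_x}_x)) = dim(span({v_y}_y)) = τ_C`." Typed with the standing assumption of a
Bell scenario, `n, m ≥ 1`, made explicit (for `n = 0` or `m = 0` the printed sentence is void). The statement is typed from PSVW's verbatim restatement (the original, [Tsirelson1987], is not held).
[cite: PrakashEtAl2017, Lemma 12 (p24), after Tsirelson1987] -/
def Tsirelson1987_lemma12 : Prop :=
  ∀ (n m : ℕ) (C : Matrix (Fin n) (Fin m) ℝ), 0 < n → 0 < m →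
    C ∈ Set.extremePoints ℝ (quantumCorrelations n m) →
    (∀ (N : ℕ) (u : Fin n → EuclideanSpace ℝ (Fin N)) (v : Fin m → EuclideanSpace ℝ (Fin N)),
      IsCSystem C u v → Submodule.span ℝ (Set.range u) = Submodule.span ℝ (Set.range v)) ∧
    ∃ τ : ℕ, 1 ≤ τ ∧ ∀ (N : ℕ) (u : Fin n → EuclideanSpace ℝ (Fin N))
      (v : Fin m → EuclideanSpace ℝ (Fin N)), IsCSystem C u v →
        Module.finrank ℝ (Submodule.span ℝ (Set.range u)) = τ

/-- **Tsirelson's theorem on extremal quantum correlations** (PSVW Theorem 20, p24, verbatim,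
attributed to [TS87]): "Let `C = (c_{xy}) ∈ ext(Cor(n,m))` and consider a family of Hermitian
operators `{A_x}_x, {B_y}_y, ρ` in `H^d` such that: (i) `c_{xy} = tr(A_x B_y ρ)` for all `x,y`;
(ii) `A_x B_y = B_y A_x`; (iii) `ρ` is a density matrix; (iv) The eigenvalues of `A_x, B_y` are in
`[−1,1]`; (v) There does not exist an orthogonal projector `P ≠ I` such that `P A_x = A_x P`,
`P B_y = B_y P` and `P ρ P = ρ`. Then, for any `C`-system of vectors `{u_x}_x, {v_y}_y` we have that
`{A_x, A_{x'}} = 2⟨u_x, u_{x'}⟩ I_d ∀ x,x'` and `{B_y, B_{y'}} = 2⟨v_y, v_{y'}⟩ I_d ∀ y,y'`, where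
`{A,B} := AB + BA`." Typed with `n, m ≥ 1` explicit, `H^d` = Hermitian matrices over any finite index type `σ`
(`d = |σ|`), "eigenvalues in `[−1,1]`" = `−I ⪯ A ⪯ I`, a density matrix = psd of trace one, an
orthogonal projector = a Hermitian idempotent. The statement is typed from PSVW's verbatim
restatement (the original, [Tsirelson1987], is not held). [cite: PrakashEtAl2017, Thm. 20 (p24), after Tsirelson1987] -/
def Tsirelson1987_thm20 : Prop :=
  ∀ (n m : ℕ) (σ : Type) [Fintype σ] [DecidableEq σ] (C : Matrix (Fin n) (Fin m) ℝ),
    0 < n → 0 < m → C ∈ Set.extremePoints ℝ (quantumCorrelations n m) →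
    ∀ (A : Fin n → Matrix σ σ ℂ) (B : Fin m → Matrix σ σ ℂ) (ρ : Matrix σ σ ℂ),
      (∀ x y, ((C x y : ℝ) : ℂ) = (A x * B y * ρ).trace) →
      (∀ x y, A x * B y = B y * A x) →
      ρ.PosSemidef → ρ.trace = 1 →
      (∀ x, (A x).IsHermitian ∧ (1 - A x).PosSemidef ∧ (1 + A x).PosSemidef) →
      (∀ y, (B y).IsHermitian ∧ (1 - B y).PosSemidef ∧ (1 + B y).PosSemidef) →
      (¬ ∃ P : Matrix σ σ ℂ, P.IsHermitian ∧ P * P = P ∧ P ≠ 1 ∧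
          (∀ x, P * A x = A x * P) ∧ (∀ y, P * B y = B y * P) ∧ P * ρ * P = ρ) →
      ∀ (N : ℕ) (u : Fin n → EuclideanSpace ℝ (Fin N)) (v : Fin m → EuclideanSpace ℝ (Fin N)),
        IsCSystem C u v →
          (∀ x x', A x * A x' + A x' * A x = ((2 * inner ℝ (u x) (u x') : ℝ) : ℂ) • 1) ∧
          (∀ y y', B y * B y' + B y' * B y = ((2 * inner ℝ (v y) (v y') : ℝ) : ℂ) • 1)

section Lemma12Proof

open scoped MatrixOrder

variable {n m : ℕ}

/-- Padding: a `C`-system of SUB-unit vectors in any `ℝ^N` shows `C ∈ Cor(n,m)` (unit vectors in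
`ℝ^{n+m}`): the matrix `Gram(u;v) + diag(1 − ‖·‖²)` is psd with unit diagonal and cross block `C`, hence
the Gram matrix of `n + m` unit vectors in `ℝ^{n+m}`. [folklore] -/
private theorem mem_quantumCorrelations_of_isCSystem {N : ℕ} {C : Matrix (Fin n) (Fin m) ℝ}
    {u : Fin n → EuclideanSpace ℝ (Fin N)} {v : Fin m → EuclideanSpace ℝ (Fin N)}
    (h : IsCSystem C u v) : C ∈ quantumCorrelations n m := by
  classical
  obtain ⟨hu, hv, hC⟩ := h
  -- all vectors in one family
  let w : Fin n ⊕ Fin m → EuclideanSpace ℝ (Fin N) := Sum.elim u v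
  have hw : ∀ i, ‖w i‖ ≤ 1 := fun i => by
    cases i with
    | inl x => exact hu x
    | inr y => exact hv y
  -- the padded Gram matrix
  let W : Matrix (Fin N) (Fin n ⊕ Fin m) ℝ := Matrix.of fun k i => (w i : EuclideanSpace ℝ (Fin N)) k
  obtain ⟨G, hG⟩ : ∃ G : Matrix (Fin n ⊕ Fin m) (Fin n ⊕ Fin m) ℝ,
      G = Wᵀ * W + Matrix.diagonal fun i => 1 - ‖w i‖ ^ 2 := ⟨_, rfl⟩
  have hWW : ∀ i j, (Wᵀ * W) i j = inner ℝ (w i) (w j) := fun i j => by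
    rw [EuclideanSpace.inner_eq_star_dotProduct, star_trivial, Matrix.mul_apply, dotProduct]
    exact Finset.sum_congr rfl fun k _ => mul_comm _ _
  have hGpsd : G.PosSemidef := by
    rw [hG]
    refine Matrix.PosSemidef.add ?_ (Matrix.PosSemidef.diagonal ?_)
    · have : Wᵀ = Wᴴ := (conjTranspose_eq_transpose_of_trivial W).symm
      rw [this]; exact posSemidef_conjTranspose_mul_self W
    · intro i
      have h1 : ‖w i‖ ^ 2 ≤ 1 := by
        have := hw i
        nlinarith [norm_nonneg (w i)]
      simp only [Pi.zero_apply, sub_nonneg]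
      exact h1
  have hGdiag : ∀ i, G i i = 1 := fun i => by
    rw [hG, Matrix.add_apply, hWW, Matrix.diagonal_apply_eq, real_inner_self_eq_norm_sq]
    ring
  have hGoff : ∀ i j, i ≠ j → G i j = inner ℝ (w i) (w j) := fun i j hij => by
    rw [hG, Matrix.add_apply, hWW, Matrix.diagonal_apply_ne _ hij, add_zero]
  -- `G = Bᵀ B`
  obtain ⟨B, hB⟩ := CStarAlgebra.nonneg_iff_eq_star_mul_self.mp hGpsd.nonneg
  have hBT : star B = Bᵀ := by
    rw [star_eq_conjTranspose, conjTranspose_eq_transpose_of_trivial]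
  let e : Fin n ⊕ Fin m ≃ Fin (n + m) := finSumFinEquiv
  let z : Fin n ⊕ Fin m → EuclideanSpace ℝ (Fin (n + m)) := fun i =>
    WithLp.toLp 2 fun k => B (e.symm k) i
  have hz : ∀ i j, inner ℝ (z i) (z j) = G i j := fun i j => by
    rw [EuclideanSpace.inner_toLp_toLp, star_trivial, dotProduct, hB, hBT, Matrix.mul_apply]
    simp only [Matrix.transpose_apply]
    rw [show ∑ x, B x i * B x j = ∑ k, B (e.symm k) i * B (e.symm k) j from
      (e.symm.sum_comp (fun x => B x i * B x j)).symm]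
    exact Finset.sum_congr rfl fun k _ => mul_comm _ _
  have hz1 : ∀ i, ‖z i‖ = 1 := fun i => by
    have h : ‖z i‖ ^ 2 = 1 := by rw [← real_inner_self_eq_norm_sq, hz, hGdiag]
    nlinarith [norm_nonneg (z i)]
  refine ⟨fun x => z (Sum.inl x), fun y => z (Sum.inr y), fun x => hz1 _, fun y => hz1 _,
    fun x y => ?_⟩
  rw [hz, hGoff _ _ Sum.inl_ne_inr]
  exact hC x y

/-- `Cor` is closed under transposition (swap the two families). [folklore] -/
private theorem transpose_mem_quantumCorrelations {C : Matrix (Fin n) (Fin m) ℝ}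
    (hC : C ∈ quantumCorrelations n m) : Cᵀ ∈ quantumCorrelations m n := by
  obtain ⟨u, v, hu, hv, hC⟩ := hC
  refine mem_quantumCorrelations_of_isCSystem (u := v) (v := u)
    ⟨fun y => (hv y).le, fun x => (hu x).le, fun y x => ?_⟩
  rw [Matrix.transpose_apply, hC, real_inner_comm]

/-- Extreme points of `Cor` are preserved under transposition. [folklore] -/
private theorem transpose_mem_extremePoints_quantumCorrelations {C : Matrix (Fin n) (Fin m) ℝ}
    (hC : C ∈ Set.extremePoints ℝ (quantumCorrelations n m)) :
    Cᵀ ∈ Set.extremePoints ℝ (quantumCorrelations m n) := by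
  rw [mem_extremePoints] at hC ⊢
  refine ⟨transpose_mem_quantumCorrelations hC.1, fun A hA B hB hseg => ?_⟩
  have hseg' : C ∈ openSegment ℝ Aᵀ Bᵀ := by
    obtain ⟨a, b, ha, hb, hab, h⟩ := hseg
    refine ⟨a, b, ha, hb, hab, ?_⟩
    have := congrArg Matrix.transpose h
    simpa only [Matrix.transpose_add, Matrix.transpose_smul, Matrix.transpose_transpose] using this
  obtain ⟨h1, h2⟩ := hC.2 Aᵀ (transpose_mem_quantumCorrelations hA) Bᵀ
    (transpose_mem_quantumCorrelations hB) hseg'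
  exact ⟨by rw [← h1, Matrix.transpose_transpose], by rw [← h2, Matrix.transpose_transpose]⟩

/-- An extreme point of `Cor(n,m)` (`m ≥ 1`) has no zero row: otherwise replacing `u_x` by `± v_{y₀}`
exhibits `C` as a midpoint. [folklore] -/
private theorem exists_apply_ne_zero_of_mem_extremePoints {C : Matrix (Fin n) (Fin m) ℝ} (hm : 0 < m)
    (hC : C ∈ Set.extremePoints ℝ (quantumCorrelations n m)) (x : Fin n) : ∃ y, C x y ≠ 0 := by
  classical
  by_contra h0
  push Not at h0
  rw [mem_extremePoints] at hC
  obtain ⟨⟨u, v, hu, hv, hCuv⟩, hext⟩ := hC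
  set y₀ : Fin m := ⟨0, hm⟩
  -- the two perturbed correlations
  let Cp : Matrix (Fin n) (Fin m) ℝ := Matrix.of fun x' y => inner ℝ (Function.update u x (v y₀) x') (v y)
  let Cm : Matrix (Fin n) (Fin m) ℝ :=
    Matrix.of fun x' y => inner ℝ (Function.update u x (-v y₀) x') (v y)
  have hCp : Cp ∈ quantumCorrelations n m := by
    refine ⟨Function.update u x (v y₀), v, fun x' => ?_, hv, fun x' y => rfl⟩
    rcases eq_or_ne x' x with rfl | hx'
    · rw [Function.update_self]; exact hv _
    · rw [Function.update_of_ne hx']; exact hu _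
  have hCm : Cm ∈ quantumCorrelations n m := by
    refine ⟨Function.update u x (-v y₀), v, fun x' => ?_, hv, fun x' y => rfl⟩
    rcases eq_or_ne x' x with rfl | hx'
    · rw [Function.update_self, norm_neg]; exact hv _
    · rw [Function.update_of_ne hx']; exact hu _
  have hseg : C ∈ openSegment ℝ Cp Cm := by
    refine ⟨1 / 2, 1 / 2, by norm_num, by norm_num, by norm_num, ?_⟩
    ext x' y
    simp only [Matrix.add_apply, Matrix.smul_apply, Matrix.of_apply, smul_eq_mul, Cp, Cm]
    rcases eq_or_ne x' x with rfl | hx'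
    · rw [Function.update_self, Function.update_self, inner_neg_left, h0]; ring
    · rw [Function.update_of_ne hx', Function.update_of_ne hx', ← hCuv]; ring
  have h1 := (hext Cp hCp Cm hCm hseg).1
  have : Cp x y₀ = 0 := by rw [h1]; exact h0 y₀
  simp only [Cp, Matrix.of_apply, Function.update_self, real_inner_self_eq_norm_sq, hv] at this
  norm_num at this

/-- **Tsirelson's rigidity, the key step**: for `C ∈ ext Cor(n,m)` (`m ≥ 1`) and ANY `C`-system, every
`u_x` lies in `span{v_y}`. Otherwise the orthogonal projection `w` of `u_x` onto that span has
`‖w‖ < ‖u_x‖ ≤ 1` and still reproduces row `x` (`⟨w, v_y⟩ = c_{xy}`); replacing `u_x` by `(1 ± ε) w`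
(`ε = 1 − ‖w‖`) gives two sub-unit systems, hence (padding) two points of `Cor(n,m)` with midpoint
`C` that differ from `C` in row `x` (nonzero by `exists_apply_ne_zero_of_mem_extremePoints`).
[cite: PrakashEtAl2017, Lemma 12 (p24), after Tsirelson1987] -/
private theorem mem_span_of_isCSystem {N : ℕ} {C : Matrix (Fin n) (Fin m) ℝ} (hm : 0 < m)
    (hC : C ∈ Set.extremePoints ℝ (quantumCorrelations n m))
    {u : Fin n → EuclideanSpace ℝ (Fin N)} {v : Fin m → EuclideanSpace ℝ (Fin N)}
    (h : IsCSystem C u v) (x : Fin n) : u x ∈ Submodule.span ℝ (Set.range v) := by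
  classical
  obtain ⟨y₁, hy₁⟩ := exists_apply_ne_zero_of_mem_extremePoints hm hC x
  obtain ⟨hu, hv, hCuv⟩ := h
  set K : Submodule ℝ (EuclideanSpace ℝ (Fin N)) := Submodule.span ℝ (Set.range v) with hK
  by_contra hx
  obtain ⟨w, hw⟩ : ∃ w : EuclideanSpace ℝ (Fin N), w = K.starProjection (u x) := ⟨_, rfl⟩
  have hvK : ∀ y, v y ∈ K := fun y => Submodule.subset_span ⟨y, rfl⟩
  have hwin : ∀ y, inner ℝ w (v y) = C x y := fun y => by
    rw [hw, Submodule.inner_starProjection_left_eq_right,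
      K.starProjection_eq_self_iff.mpr (hvK y), hCuv]
  have hwlt : ‖w‖ < 1 := by
    have hle : ‖w‖ ≤ ‖u x‖ := by rw [hw]; exact K.norm_starProjection_apply_le (u x)
    have hne : ‖w‖ ≠ ‖u x‖ := fun heq =>
      hx ((K.mem_iff_norm_starProjection (u x)).mpr (by rw [← hw, heq]))
    exact lt_of_lt_of_le (lt_of_le_of_ne hle hne) (hu x)
  -- `ε := 1 − ‖w‖ > 0`, and `‖t w‖ ≤ 1` for `|t| ≤ 1 + ε`
  obtain ⟨ε, hε⟩ : ∃ ε : ℝ, ε = 1 - ‖w‖ := ⟨_, rfl⟩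
  have hε0 : 0 < ε := by rw [hε]; linarith
  have hnorm : ∀ t : ℝ, |t| ≤ 1 + ε → ‖t • w‖ ≤ 1 := fun t ht => by
    rw [norm_smul, Real.norm_eq_abs]
    have h1 : (1 + ε) * ‖w‖ ≤ 1 := by rw [hε]; nlinarith [norm_nonneg w]
    nlinarith [norm_nonneg w, abs_nonneg t]
  -- the correlations with row `x` scaled by `t`
  let Cs : ℝ → Matrix (Fin n) (Fin m) ℝ := fun t =>
    Matrix.of fun x' y => if x' = x then t * C x y else C x' y
  have hCs : ∀ t : ℝ, |t| ≤ 1 + ε → Cs t ∈ quantumCorrelations n m := fun t ht => by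
    refine mem_quantumCorrelations_of_isCSystem (u := Function.update u x (t • w)) (v := v)
      ⟨fun x' => ?_, hv, fun x' y => ?_⟩
    · rcases eq_or_ne x' x with rfl | hx'
      · rw [Function.update_self]; exact hnorm t ht
      · rw [Function.update_of_ne hx']; exact hu _
    · simp only [Cs, Matrix.of_apply]
      rcases eq_or_ne x' x with rfl | hx'
      · rw [if_pos rfl, Function.update_self, real_inner_smul_left, hwin]
      · rw [if_neg hx', Function.update_of_ne hx', hCuv]
  have hseg : C ∈ openSegment ℝ (Cs (1 + ε)) (Cs (1 - ε)) := by
    refine ⟨1 / 2, 1 / 2, by norm_num, by norm_num, by norm_num, ?_⟩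
    ext x' y
    simp only [Matrix.add_apply, Matrix.smul_apply, Matrix.of_apply, smul_eq_mul, Cs]
    rcases eq_or_ne x' x with rfl | hx'
    · rw [if_pos rfl, if_pos rfl]; ring
    · rw [if_neg hx', if_neg hx']; ring
  rw [mem_extremePoints] at hC
  have h1 := (hC.2 _ (hCs (1 + ε) (by rw [abs_of_pos (by linarith)])) _
    (hCs (1 - ε) (by rw [abs_le]; constructor <;> linarith)) hseg).1
  have h2 : (1 + ε) * C x y₁ = C x y₁ := by
    have := congrFun (congrFun h1 x) y₁
    simpa [Cs] using this
  have h3 : ε * C x y₁ = 0 := by linarith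
  exact hy₁ ((mul_eq_zero.mp h3).resolve_left hε0.ne')

/-- For a `C`-system with `v_y ∈ span{u_x}` for all `y`, `rank C = dim span{v_y}`: writing
`C = Uᵀ V` (columns `u_x`, `v_y`), `ker(Uᵀ V) = ker V` since `col(V) ⊆ col(U)`. [folklore] -/
private theorem rank_eq_finrank_span_of_isCSystem {N : ℕ} {C : Matrix (Fin n) (Fin m) ℝ}
    {u : Fin n → EuclideanSpace ℝ (Fin N)} {v : Fin m → EuclideanSpace ℝ (Fin N)}
    (h : IsCSystem C u v) (hvu : ∀ y, v y ∈ Submodule.span ℝ (Set.range u)) :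
    C.rank = Module.finrank ℝ (Submodule.span ℝ (Set.range v)) := by
  classical
  let U : Matrix (Fin N) (Fin n) ℝ := Matrix.of fun i x => (u x : EuclideanSpace ℝ (Fin N)) i
  let V : Matrix (Fin N) (Fin m) ℝ := Matrix.of fun i y => (v y : EuclideanSpace ℝ (Fin N)) i
  have hC : C = Uᵀ * V := by
    ext x y
    rw [h.2.2 x y, EuclideanSpace.inner_eq_star_dotProduct, star_trivial, Matrix.mul_apply,
      dotProduct]
    exact Finset.sum_congr rfl fun i _ => mul_comm _ _
  -- the coordinate map `ofLp` carries `span{v_y}` to the column span of `V`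
  let e := WithLp.linearEquiv 2 ℝ (Fin N → ℝ)
  have hVcol : Set.range V.col = e '' Set.range v := by
    rw [← Set.range_comp]; rfl
  have hUcol : Set.range U.col = e '' Set.range u := by
    rw [← Set.range_comp]; rfl
  have hVspan : Submodule.span ℝ (Set.range V.col) =
      (Submodule.span ℝ (Set.range v)).map (e : _ →ₗ[ℝ] (Fin N → ℝ)) := by
    rw [hVcol, ← Submodule.span_image]; rfl
  have hUspan : Submodule.span ℝ (Set.range U.col) =
      (Submodule.span ℝ (Set.range u)).map (e : _ →ₗ[ℝ] (Fin N → ℝ)) := by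
    rw [hUcol, ← Submodule.span_image]; rfl
  have hfin : Module.finrank ℝ (Submodule.span ℝ (Set.range v)) =
      Module.finrank ℝ (Submodule.span ℝ (Set.range V.col)) := by
    rw [hVspan, LinearEquiv.finrank_map_eq]
  rw [hfin, ← Matrix.rank_eq_finrank_span_cols, hC]
  -- `rank (Uᵀ V) = rank V` via equal kernels
  have hcolle : Submodule.span ℝ (Set.range V.col) ≤ Submodule.span ℝ (Set.range U.col) := by
    rw [hVspan, hUspan]
    refine Submodule.map_mono (Submodule.span_le.mpr ?_)
    rintro _ ⟨y, rfl⟩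
    exact hvu y
  have hker : LinearMap.ker (Uᵀ * V).mulVecLin = LinearMap.ker V.mulVecLin := by
    ext w
    simp only [LinearMap.mem_ker, Matrix.mulVecLin_apply]
    constructor
    · intro hw
      have hmem : V *ᵥ w ∈ LinearMap.range U.mulVecLin := by
        rw [Matrix.range_mulVecLin]
        refine hcolle ?_
        rw [← Matrix.range_mulVecLin]
        exact ⟨w, rfl⟩
      obtain ⟨a, ha⟩ := hmem
      rw [Matrix.mulVecLin_apply] at ha
      have h0 : (U *ᵥ a) ⬝ᵥ (U *ᵥ a) = 0 :=
        calc (U *ᵥ a) ⬝ᵥ (U *ᵥ a) = (a ᵥ* Uᵀ) ⬝ᵥ (U *ᵥ a) := by rw [vecMul_transpose]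
          _ = a ⬝ᵥ (Uᵀ *ᵥ (U *ᵥ a)) := (dotProduct_mulVec a Uᵀ (U *ᵥ a)).symm
          _ = 0 := by rw [ha, mulVec_mulVec, hw, dotProduct_zero]
      rw [← ha]
      exact dotProduct_self_eq_zero.mp h0
    · intro hw
      rw [← mulVec_mulVec, hw, mulVec_zero]
  have h1 := LinearMap.finrank_range_add_finrank_ker (Uᵀ * V).mulVecLin
  have h2 := LinearMap.finrank_range_add_finrank_ker V.mulVecLin
  rw [hker] at h1
  unfold Matrix.rank
  omega

/-- **Discharge of `Tsirelson1987_lemma12`** (PSVW Lemma 12 = [TS87]): both halves from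
`mem_span_of_isCSystem` (applied to `C` and, via `transpose_mem_extremePoints_quantumCorrelations`,
to `Cᵀ`), with `τ_C := rank C` by `rank_eq_finrank_span_of_isCSystem`; `τ_C ≥ 1` because an extreme
point has a nonzero entry. [cite: PrakashEtAl2017, Lemma 12 (p24), after Tsirelson1987] -/
theorem Tsirelson1987_lemma12_holds : Tsirelson1987_lemma12 := by
  intro n m C hn hm hC
  classical
  have hT := transpose_mem_extremePoints_quantumCorrelations hC
  have hspan : ∀ (N : ℕ) (u : Fin n → EuclideanSpace ℝ (Fin N))
      (v : Fin m → EuclideanSpace ℝ (Fin N)), IsCSystem C u v →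
        Submodule.span ℝ (Set.range u) = Submodule.span ℝ (Set.range v) := by
    intro N u v h
    apply le_antisymm
    · rw [Submodule.span_le]
      rintro _ ⟨x, rfl⟩
      exact mem_span_of_isCSystem hm hC h x
    · rw [Submodule.span_le]
      rintro _ ⟨y, rfl⟩
      have h' : IsCSystem Cᵀ v u :=
        ⟨h.2.1, h.1, fun y x => by rw [Matrix.transpose_apply, h.2.2, real_inner_comm]⟩
      exact mem_span_of_isCSystem hn hT h' y
  have hvu : ∀ (N : ℕ) (u : Fin n → EuclideanSpace ℝ (Fin N))
      (v : Fin m → EuclideanSpace ℝ (Fin N)), IsCSystem C u v →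
        ∀ y, v y ∈ Submodule.span ℝ (Set.range u) := fun N u v h y => by
    rw [hspan N u v h]; exact Submodule.subset_span ⟨y, rfl⟩
  refine ⟨hspan, C.rank, ?_, fun N u v h => ?_⟩
  · -- `1 ≤ rank C`: use the unit `C`-system provided by `C ∈ Cor(n,m)`
    obtain ⟨u₀, v₀, hu₀, hv₀, hC₀⟩ := hC.1
    have h₀ : IsCSystem C u₀ v₀ := ⟨fun x => (hu₀ x).le, fun y => (hv₀ y).le, hC₀⟩
    rw [rank_eq_finrank_span_of_isCSystem h₀ (hvu _ _ _ h₀), Submodule.one_le_finrank_iff, Ne,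
      Submodule.span_eq_bot]
    intro h0
    have := h0 (v₀ ⟨0, hm⟩) ⟨_, rfl⟩
    have h1 := hv₀ ⟨0, hm⟩
    rw [this, norm_zero] at h1
    exact zero_ne_one h1
  · rw [hspan N u v h]
    exact (rank_eq_finrank_span_of_isCSystem h (hvu _ _ _ h)).symm

/-- **PSVW Lemma 12 — the value of `τ_C`** (p24: "there exists an integer `τ_C ≥ 1`, depending
only on `C`"; in the proof of `Tsirelson1987_lemma12_holds` one takes `τ_C = rank C`, cf. PSVW's
remark "`rank(C) ≤ τ_C`" and GdLL Lemma 3.2 (ii) "`rank(E) = rank(C)`"): for an extreme point `C` of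
`Cor(n,m)` (`n, m ≥ 1`) and ANY `C`-system `{u_x}, {v_y}`, `dim span{u_x} = rank C`. (Recorded as a
public corollary so that dimension bounds stated via `τ_C` can be expressed via `rank C`.)
[cite: PrakashEtAl2017, Lemma 12 (p24), after Tsirelson1987; GriblingDelaatLaurent2017, Lemma 3.2 (ii) (p08–p09)] -/
theorem finrank_span_eq_rank_of_mem_extremePoints {N : ℕ} {C : Matrix (Fin n) (Fin m) ℝ}
    (hn : 0 < n) (hm : 0 < m) (hC : C ∈ Set.extremePoints ℝ (quantumCorrelations n m))
    {u : Fin n → EuclideanSpace ℝ (Fin N)} {v : Fin m → EuclideanSpace ℝ (Fin N)}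
    (h : IsCSystem C u v) :
    Module.finrank ℝ (Submodule.span ℝ (Set.range u)) = C.rank := by
  obtain ⟨hspan, -⟩ := Tsirelson1987_lemma12_holds n m C hn hm hC
  have hvu : ∀ y, v y ∈ Submodule.span ℝ (Set.range u) := fun y => by
    rw [hspan N u v h]; exact Submodule.subset_span ⟨y, rfl⟩
  rw [rank_eq_finrank_span_of_isCSystem h hvu, hspan N u v h]

end Lemma12Proof

/-! ## Proof of Theorem 20 (`Tsirelson1987_thm20_holds`)

An elementary argument, independent of [TS87] (not held). Notation: `C ∈ ext Cor(n,m)`, `n, m ≥ 1`;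
`(u, v)` any `C`-system, `w = (u; v)` the joint family, `G` its Gram matrix.

**A. Convex side (real vectors).** (A1) scaled direct sums `ℝ^{N₁} ⊕ ℝ^{N₂} → ℝ^{N₁+N₂}`;
(A2) `Cor(n,m)` is convex; (A3) an extreme point written as a finite convex combination of points of
the set equals every positively weighted point; (A4) GRAM RIGIDITY: two `C`-systems of an extreme
`C` have the same Gram matrix (Lemma 12 applied to their direct sum gives ONE coefficient vector
`u_x = Σ_y λ_y v_y` for both, so `⟨u_{x'}, u_x⟩ = Σ_y λ_y c_{x'y}` is system-independent; the
`v`-block by transposition), and all their vectors are unit vectors; (A5) hence linear relations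
transfer between `C`-systems; (A6) QUADRATIC RIGIDITY: a symmetric `D` with zero diagonal and
`Σ_i t_i w_i = 0 ⇒ Dt = 0` vanishes — in orthonormal coordinates `U` of `span{w_i}` one has
`D = USUᵀ`, `G ± tD = U(I ± tS)Uᵀ ⪰ 0` for small `t`, unit diagonal, so `G ± tD` are Gram matrices
of systems realising `C ± tD_{uv} ∈ Cor(n,m)` with midpoint `C`; extremality makes them
`C`-systems and (A4) forces `G + tD = G` (Li–Tam's argument for the elliptope, run inside `Cor`).

**B. Operator side.** (B0) `−I ⪯ A ⪯ I ⇒ I − A² = (I+A)^{1/2}(I−A)(I+A)^{1/2} ⪰ 0` (functional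
calculus square root commuting with `I − A`), so `‖Aκ‖ ≤ ‖κ‖`; (B1) realification
`ℂ^σ → ℝ^{2|σ|}` with `⟨Rξ, Rη⟩ = Re(ξ*η)`; (B2) spectral data of `ρ`: orthonormal `κ_j` with
`Tr(Xρ) = Σ_j λ_j κ_j*Xκ_j`; the pure correlations `C(κ_j) = (Re κ_j*A_xB_yκ_j) ∈ Cor(n,m)`
(systems `(R A_xκ_j, R B_yκ_j)`) average to `C`, so `C(κ_j) = C` whenever `λ_j > 0` (A3); (B3) the
`B`-cyclic hull `M` of `{κ_j : λ_j > 0}` and its orthogonal projector as a matrix; (B4) by (A5) and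
Lemma 12, `A_xκ_j = (Σ_y λ_{xy}B_y)κ_j`, `B_yκ_j = (Σ_x μ_{yx}A_x)κ_j`, and by (A4) `A_x²κ_j = κ_j`;
hence `M` is `A`-invariant, its projector commutes with everything and fixes `ρ`, so `M = ℂ^σ` by
condition (v), and an operator commuting with all `B_y` and killing the `κ_j` is `0`; applying (A6)
to `D_{ii'} = Re η*({W_i,W_{i'}}/2 − G_{ii'})κ_j` (`W = (A_x; Σ_x μ_{yx}A_x)`) gives
`{A_x,A_{x'}}κ_j = 2⟨u_x,u_{x'}⟩κ_j`, and `{A_x,A_{x'}} − 2⟨u_x,u_{x'}⟩I` commutes with the `B_y`;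
(B5) the `B`-side is the `A`-side for `(Cᵀ, B, A, v, u)`.
-/

section Thm20Proof

open Finset
open scoped MatrixOrder

variable {n m : ℕ}

/-! #### A1. Scaled direct sums of real vectors -/

/-- Scaled direct sum `(a f, b g) ∈ ℝ^{N₁+N₂}` of `f ∈ ℝ^{N₁}`, `g ∈ ℝ^{N₂}`. [folklore] -/
private def vconcat {N₁ N₂ : ℕ} (a b : ℝ) (f : EuclideanSpace ℝ (Fin N₁))
    (g : EuclideanSpace ℝ (Fin N₂)) : EuclideanSpace ℝ (Fin (N₁ + N₂)) :=
  WithLp.toLp 2 (Fin.addCases (fun i => a * f i) (fun j => b * g j))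

/-- `⟨(af, bg), (af', bg')⟩ = a²⟨f,f'⟩ + b²⟨g,g'⟩`. [folklore] -/
private theorem inner_vconcat {N₁ N₂ : ℕ} (a b : ℝ) (f f' : EuclideanSpace ℝ (Fin N₁))
    (g g' : EuclideanSpace ℝ (Fin N₂)) :
    inner ℝ (vconcat a b f g) (vconcat a b f' g') =
      a * a * inner ℝ f f' + b * b * inner ℝ g g' := by
  simp only [vconcat, EuclideanSpace.inner_toLp_toLp, star_trivial, dotProduct, Fin.sum_univ_add,
    Fin.addCases_left, Fin.addCases_right]
  rw [EuclideanSpace.inner_eq_star_dotProduct, EuclideanSpace.inner_eq_star_dotProduct, star_trivial,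
    star_trivial, dotProduct, dotProduct, Finset.mul_sum, Finset.mul_sum]
  congr 1 <;> refine Finset.sum_congr rfl fun i _ => ?_ <;> ring

/-- First block of a vector of `ℝ^{N₁+N₂}` (a linear map). [folklore] -/
private def vfst (N₁ N₂ : ℕ) : EuclideanSpace ℝ (Fin (N₁ + N₂)) →ₗ[ℝ] EuclideanSpace ℝ (Fin N₁) where
  toFun w := WithLp.toLp 2 fun i => w (Fin.castAdd N₂ i)
  map_add' w w' := by ext i; simp
  map_smul' c w := by ext i; simp

/-- Second block of a vector of `ℝ^{N₁+N₂}` (a linear map). [folklore] -/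
private def vsnd (N₁ N₂ : ℕ) : EuclideanSpace ℝ (Fin (N₁ + N₂)) →ₗ[ℝ] EuclideanSpace ℝ (Fin N₂) where
  toFun w := WithLp.toLp 2 fun j => w (Fin.natAdd N₁ j)
  map_add' w w' := by ext i; simp
  map_smul' c w := by ext i; simp

/-- First block of a scaled direct sum. [folklore] -/
private theorem vfst_vconcat {N₁ N₂ : ℕ} (a b : ℝ) (f : EuclideanSpace ℝ (Fin N₁))
    (g : EuclideanSpace ℝ (Fin N₂)) : vfst N₁ N₂ (vconcat a b f g) = a • f := by
  ext i
  simp [vfst, vconcat]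

/-- Second block of a scaled direct sum. [folklore] -/
private theorem vsnd_vconcat {N₁ N₂ : ℕ} (a b : ℝ) (f : EuclideanSpace ℝ (Fin N₁))
    (g : EuclideanSpace ℝ (Fin N₂)) : vsnd N₁ N₂ (vconcat a b f g) = b • g := by
  ext i
  simp [vsnd, vconcat]

/-! #### A2. `Cor(n,m)` is convex -/

/-- `Cor(n,m)` is convex: a convex combination `a C₁ + b C₂` is realised by the direct-sum system
`(√a u¹ ⊕ √b u², √a v¹ ⊕ √b v²)`. [folklore] -/
private theorem convex_quantumCorrelations : Convex ℝ (quantumCorrelations n m) := by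
  intro C₁ h₁ C₂ h₂ a b ha hb hab
  obtain ⟨u₁, v₁, hu₁, hv₁, hC₁⟩ := h₁
  obtain ⟨u₂, v₂, hu₂, hv₂, hC₂⟩ := h₂
  refine mem_quantumCorrelations_of_isCSystem
    (u := fun x => vconcat (Real.sqrt a) (Real.sqrt b) (u₁ x) (u₂ x))
    (v := fun y => vconcat (Real.sqrt a) (Real.sqrt b) (v₁ y) (v₂ y)) ⟨fun x => ?_, fun y => ?_,
      fun x y => ?_⟩
  · have h : ‖vconcat (Real.sqrt a) (Real.sqrt b) (u₁ x) (u₂ x)‖ ^ 2 = 1 := by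
      rw [← real_inner_self_eq_norm_sq, inner_vconcat, real_inner_self_eq_norm_sq,
        real_inner_self_eq_norm_sq, hu₁, hu₂, Real.mul_self_sqrt ha, Real.mul_self_sqrt hb]
      linarith
    nlinarith [norm_nonneg (vconcat (Real.sqrt a) (Real.sqrt b) (u₁ x) (u₂ x))]
  · have h : ‖vconcat (Real.sqrt a) (Real.sqrt b) (v₁ y) (v₂ y)‖ ^ 2 = 1 := by
      rw [← real_inner_self_eq_norm_sq, inner_vconcat, real_inner_self_eq_norm_sq,
        real_inner_self_eq_norm_sq, hv₁, hv₂, Real.mul_self_sqrt ha, Real.mul_self_sqrt hb]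
      linarith
    nlinarith [norm_nonneg (vconcat (Real.sqrt a) (Real.sqrt b) (v₁ y) (v₂ y))]
  · rw [inner_vconcat, Real.mul_self_sqrt ha, Real.mul_self_sqrt hb, ← hC₁, ← hC₂]
    simp [Matrix.add_apply, Matrix.smul_apply]

/-! #### A3. Extreme points and finite convex combinations -/

/-- If an extreme point `x` of a convex set `s` is a convex combination `∑ w_i z_i` of points of `s`,
then every `z_i` with positive weight equals `x`. [folklore] -/
private theorem eq_of_mem_extremePoints_of_sum_smul {E ι : Type*} [AddCommGroup E] [Module ℝ E]
    {s : Set E} (hs : Convex ℝ s) {x : E} (hx : x ∈ Set.extremePoints ℝ s) (t : Finset ι)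
    (w : ι → ℝ) (z : ι → E) (hw : ∀ i ∈ t, 0 ≤ w i) (hw1 : ∑ i ∈ t, w i = 1)
    (hz : ∀ i ∈ t, z i ∈ s) (hsum : ∑ i ∈ t, w i • z i = x) :
    ∀ i ∈ t, 0 < w i → z i = x := by
  classical
  by_contra hcon
  push Not at hcon
  obtain ⟨i₀, hi₀, hwi₀, hzi₀⟩ := hcon
  -- the indices carrying points different from `x`, and the rest
  set J := t.filter fun i => z i ≠ x with hJ
  set J' := t.filter fun i => ¬ z i ≠ x with hJ'
  have hi₀J : i₀ ∈ J := Finset.mem_filter.mpr ⟨hi₀, hzi₀⟩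
  have hWJ : 0 < ∑ i ∈ J, w i :=
    lt_of_lt_of_le hwi₀ (Finset.single_le_sum (fun i hi => hw i (Finset.mem_filter.mp hi).1) hi₀J)
  have hzJ' : ∀ i ∈ J', z i = x := fun i hi => by
    have := (Finset.mem_filter.mp hi).2
    push Not at this
    exact this
  -- `x = ∑_{J} w_i z_i + (∑_{J'} w_i) • x`
  have hsplit : ∑ i ∈ t, w i • z i = ∑ i ∈ J, w i • z i + (∑ i ∈ J', w i) • x := by
    rw [← Finset.sum_filter_add_sum_filter_not t (fun i => z i ≠ x), Finset.sum_smul]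
    congr 1
    exact Finset.sum_congr rfl fun i hi => by rw [hzJ' i hi]
  have hwsplit : ∑ i ∈ t, w i = ∑ i ∈ J, w i + ∑ i ∈ J', w i :=
    (Finset.sum_filter_add_sum_filter_not t (fun i => z i ≠ x) w).symm
  have hcm : J.centerMass w z ∈ s \ {x} := by
    have hconv : Convex ℝ (s \ {x}) :=
      ((Convex.mem_extremePoints_iff_convex_sdiff hs).mp hx).2
    refine hconv.centerMass_mem (fun i hi => hw i (Finset.mem_filter.mp hi).1) hWJ fun i hi => ?_
    exact ⟨hz i (Finset.mem_filter.mp hi).1, (Finset.mem_filter.mp hi).2⟩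
  -- but the center of mass is `x`
  have hcmx : J.centerMass w z = x := by
    rw [Finset.centerMass]
    have h1 : ∑ i ∈ J, w i • z i = (∑ i ∈ J, w i) • x := by
      have h := hsum
      rw [hsplit] at h
      have h' : ∑ i ∈ J, w i • z i = x - (∑ i ∈ J', w i) • x := eq_sub_of_add_eq h
      rw [h', show (∑ i ∈ J, w i) = 1 - ∑ i ∈ J', w i by linarith [hwsplit, hw1], sub_smul,
        one_smul]
    rw [h1, smul_smul, inv_mul_cancel₀ hWJ.ne', one_smul]
  exact hcm.2 hcmx

/-! #### A4. All `C`-systems of an extreme `C` have the same Gram matrix, and unit vectors -/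

/-- Two `C`-systems of an extreme `C` have the same `u`-Gram matrix: in the direct-sum system
`((u_x ⊕ u'_x)/√2, (v_y ⊕ v'_y)/√2)` Lemma 12 writes `u_x ⊕ u'_x` over the `v_y ⊕ v'_y` with ONE
coefficient vector, so `⟨u_{x'}, u_x⟩ = Σ_y λ_y c_{x'y} = ⟨u'_{x'}, u'_x⟩`. [folklore] -/
private theorem inner_eq_of_isCSystem {N N' : ℕ} {C : Matrix (Fin n) (Fin m) ℝ} (hn : 0 < n)
    (hm : 0 < m) (hC : C ∈ Set.extremePoints ℝ (quantumCorrelations n m))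
    {u : Fin n → EuclideanSpace ℝ (Fin N)} {v : Fin m → EuclideanSpace ℝ (Fin N)}
    {u' : Fin n → EuclideanSpace ℝ (Fin N')} {v' : Fin m → EuclideanSpace ℝ (Fin N')}
    (h : IsCSystem C u v) (h' : IsCSystem C u' v') (x x' : Fin n) :
    inner ℝ (u x) (u x') = inner ℝ (u' x) (u' x') := by
  classical
  obtain ⟨hu, hv, hCuv⟩ := h
  obtain ⟨hu', hv', hCuv'⟩ := h'
  obtain ⟨c, hc⟩ : ∃ c : ℝ, c = Real.sqrt (1 / 2) := ⟨_, rfl⟩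
  have hcc : c * c = 1 / 2 := by rw [hc]; exact Real.mul_self_sqrt (by norm_num)
  have hc0 : c ≠ 0 := fun h0 => by rw [h0, mul_zero] at hcc; norm_num at hcc
  let U : Fin n → EuclideanSpace ℝ (Fin (N + N')) := fun x => vconcat c c (u x) (u' x)
  let V : Fin m → EuclideanSpace ℝ (Fin (N + N')) := fun y => vconcat c c (v y) (v' y)
  have hnorm : ∀ {M M' : ℕ} (f : EuclideanSpace ℝ (Fin M)) (g : EuclideanSpace ℝ (Fin M')),
      ‖f‖ ≤ 1 → ‖g‖ ≤ 1 → ‖vconcat c c f g‖ ≤ 1 := by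
    intro M M' f g hf hg
    have h2 : ‖vconcat c c f g‖ ^ 2 ≤ 1 := by
      rw [← real_inner_self_eq_norm_sq, inner_vconcat, real_inner_self_eq_norm_sq,
        real_inner_self_eq_norm_sq, hcc]
      nlinarith [norm_nonneg f, norm_nonneg g]
    nlinarith [norm_nonneg (vconcat c c f g)]
  have hUV : IsCSystem C U V := by
    refine ⟨fun x => hnorm _ _ (hu x) (hu' x), fun y => hnorm _ _ (hv y) (hv' y), fun x y => ?_⟩
    change C x y = inner ℝ (vconcat c c (u x) (u' x)) (vconcat c c (v y) (v' y))
    rw [inner_vconcat, hcc, ← hCuv, ← hCuv']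
    ring
  have hspan := ((Tsirelson1987_lemma12_holds n m C hn hm hC).1 (N + N') U V hUV)
  have hx : U x' ∈ Submodule.span ℝ (Set.range V) := by
    rw [← hspan]; exact Submodule.subset_span ⟨x', rfl⟩
  obtain ⟨coef, hcoef⟩ := (Submodule.mem_span_range_iff_exists_fun ℝ).mp hx
  -- project onto the two blocks
  have h1 : u x' = ∑ y, coef y • v y := by
    have h := congrArg (vfst N N') hcoef
    rw [map_sum] at h
    simp only [map_smul, U, V, vfst_vconcat] at h
    simp only [smul_comm _ c, ← Finset.smul_sum] at h
    exact (smul_right_injective _ hc0 h).symm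
  have h2 : u' x' = ∑ y, coef y • v' y := by
    have h := congrArg (vsnd N N') hcoef
    rw [map_sum] at h
    simp only [map_smul, U, V, vsnd_vconcat] at h
    simp only [smul_comm _ c, ← Finset.smul_sum] at h
    exact (smul_right_injective _ hc0 h).symm
  rw [h1, h2, inner_sum, inner_sum]
  refine Finset.sum_congr rfl fun y _ => ?_
  rw [real_inner_smul_right, real_inner_smul_right, ← hCuv, ← hCuv']

/-- The transposed system is a `Cᵀ`-system. [folklore] -/
private theorem IsCSystem.transpose {N : ℕ} {C : Matrix (Fin n) (Fin m) ℝ}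
    {u : Fin n → EuclideanSpace ℝ (Fin N)} {v : Fin m → EuclideanSpace ℝ (Fin N)}
    (h : IsCSystem C u v) : IsCSystem Cᵀ v u :=
  ⟨h.2.1, h.1, fun y x => by rw [Matrix.transpose_apply, h.2.2, real_inner_comm]⟩

/-- The `v`-Grams of two `C`-systems of an extreme `C` agree (transpose of `inner_eq_of_isCSystem`).
[folklore] -/
private theorem inner_eq_of_isCSystem' {N N' : ℕ} {C : Matrix (Fin n) (Fin m) ℝ} (hn : 0 < n)
    (hm : 0 < m) (hC : C ∈ Set.extremePoints ℝ (quantumCorrelations n m))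
    {u : Fin n → EuclideanSpace ℝ (Fin N)} {v : Fin m → EuclideanSpace ℝ (Fin N)}
    {u' : Fin n → EuclideanSpace ℝ (Fin N')} {v' : Fin m → EuclideanSpace ℝ (Fin N')}
    (h : IsCSystem C u v) (h' : IsCSystem C u' v') (y y' : Fin m) :
    inner ℝ (v y) (v y') = inner ℝ (v' y) (v' y') :=
  inner_eq_of_isCSystem hm hn (transpose_mem_extremePoints_quantumCorrelations hC) h.transpose
    h'.transpose y y'

/-- The full Gram matrices (families `u ⊔ v`) of two `C`-systems of an extreme `C` agree. [folklore] -/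
private theorem inner_elim_eq_of_isCSystem {N N' : ℕ} {C : Matrix (Fin n) (Fin m) ℝ} (hn : 0 < n)
    (hm : 0 < m) (hC : C ∈ Set.extremePoints ℝ (quantumCorrelations n m))
    {u : Fin n → EuclideanSpace ℝ (Fin N)} {v : Fin m → EuclideanSpace ℝ (Fin N)}
    {u' : Fin n → EuclideanSpace ℝ (Fin N')} {v' : Fin m → EuclideanSpace ℝ (Fin N')}
    (h : IsCSystem C u v) (h' : IsCSystem C u' v') (i j : Fin n ⊕ Fin m) :
    inner ℝ (Sum.elim u v i) (Sum.elim u v j) = inner ℝ (Sum.elim u' v' i) (Sum.elim u' v' j) := by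
  cases i with
  | inl x =>
    cases j with
    | inl x' => exact inner_eq_of_isCSystem hn hm hC h h' x x'
    | inr y => simp only [Sum.elim_inl, Sum.elim_inr]; rw [← h.2.2, ← h'.2.2]
  | inr y =>
    cases j with
    | inl x => simp only [Sum.elim_inl, Sum.elim_inr]; rw [real_inner_comm, ← h.2.2,
        real_inner_comm, ← h'.2.2]
    | inr y' => exact inner_eq_of_isCSystem' hn hm hC h h' y y'

/-- Every `C`-system of an extreme `C` consists of UNIT vectors (compare with the unit system
witnessing `C ∈ Cor`). [folklore] -/
private theorem norm_eq_one_of_isCSystem {N : ℕ} {C : Matrix (Fin n) (Fin m) ℝ} (hn : 0 < n)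
    (hm : 0 < m) (hC : C ∈ Set.extremePoints ℝ (quantumCorrelations n m))
    {u : Fin n → EuclideanSpace ℝ (Fin N)} {v : Fin m → EuclideanSpace ℝ (Fin N)}
    (h : IsCSystem C u v) : (∀ x, ‖u x‖ = 1) ∧ ∀ y, ‖v y‖ = 1 := by
  obtain ⟨u₀, v₀, hu₀, hv₀, hC₀⟩ := hC.1
  have h₀ : IsCSystem C u₀ v₀ := ⟨fun x => (hu₀ x).le, fun y => (hv₀ y).le, hC₀⟩
  refine ⟨fun x => ?_, fun y => ?_⟩
  · have h2 : ‖u x‖ ^ 2 = 1 := by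
      rw [← real_inner_self_eq_norm_sq, inner_eq_of_isCSystem hn hm hC h h₀ x x,
        real_inner_self_eq_norm_sq, hu₀, one_pow]
    nlinarith [norm_nonneg (u x)]
  · have h2 : ‖v y‖ ^ 2 = 1 := by
      rw [← real_inner_self_eq_norm_sq, inner_eq_of_isCSystem' hn hm hC h h₀ y y,
        real_inner_self_eq_norm_sq, hv₀, one_pow]
    nlinarith [norm_nonneg (v y)]

/-! #### A5. Linear relations transfer between `C`-systems -/

/-- Families with the same Gram matrix have the same norms of linear combinations. [folklore] -/
private theorem norm_sum_smul_eq_of_inner_eq {ι : Type*} [Fintype ι] {E E' : Type*}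
    [NormedAddCommGroup E] [InnerProductSpace ℝ E] [NormedAddCommGroup E'] [InnerProductSpace ℝ E']
    (w : ι → E) (w' : ι → E') (hG : ∀ i j, inner ℝ (w i) (w j) = inner ℝ (w' i) (w' j))
    (c : ι → ℝ) : ‖∑ i, c i • w i‖ = ‖∑ i, c i • w' i‖ := by
  have h : ‖∑ i, c i • w i‖ ^ 2 = ‖∑ i, c i • w' i‖ ^ 2 := by
    rw [← real_inner_self_eq_norm_sq, ← real_inner_self_eq_norm_sq, sum_inner, sum_inner]
    refine Finset.sum_congr rfl fun i _ => ?_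
    rw [inner_sum, inner_sum]
    refine Finset.sum_congr rfl fun j _ => ?_
    rw [real_inner_smul_left, real_inner_smul_left, real_inner_smul_right, real_inner_smul_right, hG]
  nlinarith [norm_nonneg (∑ i, c i • w i), norm_nonneg (∑ i, c i • w' i)]

/-! #### A6. Quadratic rigidity of the Gram matrix of a `C`-system of an extreme `C` -/

/-- Gram vectors of a real psd matrix, in `ℝ^{|ι|}`. [folklore] -/
private theorem exists_gram_of_posSemidef {ι : Type} [Fintype ι] [DecidableEq ι]
    {X : Matrix ι ι ℝ} (hX : X.PosSemidef) :
    ∃ z : ι → EuclideanSpace ℝ (Fin (Fintype.card ι)), ∀ i j, inner ℝ (z i) (z j) = X i j := by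
  classical
  obtain ⟨B, hB⟩ := CStarAlgebra.nonneg_iff_eq_star_mul_self.mp hX.nonneg
  have hBT : star B = Bᵀ := by
    rw [star_eq_conjTranspose, conjTranspose_eq_transpose_of_trivial]
  let e : ι ≃ Fin (Fintype.card ι) := Fintype.equivFin ι
  refine ⟨fun i => WithLp.toLp 2 fun k => B (e.symm k) i, fun i j => ?_⟩
  rw [EuclideanSpace.inner_toLp_toLp, star_trivial, dotProduct, hB, hBT, Matrix.mul_apply]
  simp only [Matrix.transpose_apply]
  rw [show ∑ x, B x i * B x j = ∑ k, B (e.symm k) i * B (e.symm k) j from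
    (e.symm.sum_comp (fun x => B x i * B x j)).symm]
  exact Finset.sum_congr rfl fun k _ => mul_comm _ _

/-- `|xᵀ S x| ≤ (Σ |S_{jk}|) ‖x‖²`. [folklore] -/
private theorem abs_dotProduct_mulVec_le {τ : Type} [Fintype τ] (S : Matrix τ τ ℝ) (x : τ → ℝ) :
    |x ⬝ᵥ (S *ᵥ x)| ≤ (∑ j, ∑ k, |S j k|) * (x ⬝ᵥ x) := by
  have hxx : x ⬝ᵥ x = ∑ l, x l ^ 2 := by
    simp only [dotProduct, pow_two]
  have hsq : ∀ j k, |x j| * |x k| ≤ ∑ l, x l ^ 2 := fun j k => by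
    have h1 : x j ^ 2 ≤ ∑ l, x l ^ 2 := Finset.single_le_sum (fun l _ => sq_nonneg (x l)) (mem_univ j)
    have h2 : x k ^ 2 ≤ ∑ l, x l ^ 2 := Finset.single_le_sum (fun l _ => sq_nonneg (x l)) (mem_univ k)
    nlinarith [two_mul_le_add_sq (|x j|) (|x k|), sq_abs (x j), sq_abs (x k), abs_nonneg (x j),
      abs_nonneg (x k)]
  rw [hxx]
  calc |x ⬝ᵥ (S *ᵥ x)| = |∑ j, ∑ k, x j * S j k * x k| := by
        simp only [dotProduct, mulVec, Finset.mul_sum, mul_assoc]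
    _ ≤ ∑ j, |∑ k, x j * S j k * x k| := abs_sum_le_sum_abs _ _
    _ ≤ ∑ j, ∑ k, |x j * S j k * x k| := Finset.sum_le_sum fun j _ => abs_sum_le_sum_abs _ _
    _ ≤ ∑ j, ∑ k, |S j k| * ∑ l, x l ^ 2 := by
        refine Finset.sum_le_sum fun j _ => Finset.sum_le_sum fun k _ => ?_
        rw [abs_mul, abs_mul]
        nlinarith [hsq j k, abs_nonneg (S j k), abs_nonneg (x j), abs_nonneg (x k)]
    _ = (∑ j, ∑ k, |S j k|) * ∑ l, x l ^ 2 := by rw [Finset.sum_mul]; simp only [Finset.sum_mul]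

/-- `I + tS ⪰ 0` for a symmetric `S` when `|t| Σ|S_{jk}| ≤ 1`. [folklore] -/
private theorem posSemidef_one_add_smul_of_small {τ : Type} [Fintype τ] [DecidableEq τ]
    (S : Matrix τ τ ℝ) (hS : Sᵀ = S) {t : ℝ} (ht : |t| * ∑ j, ∑ k, |S j k| ≤ 1) :
    (1 + t • S).PosSemidef := by
  refine PosSemidef.of_dotProduct_mulVec_nonneg ?_ fun x => ?_
  · rw [IsHermitian, conjTranspose_eq_transpose_of_trivial, transpose_add, transpose_one,
      transpose_smul, hS]
  · rw [star_trivial, add_mulVec, one_mulVec, smul_mulVec, dotProduct_add, dotProduct_smul,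
      smul_eq_mul]
    have hq := abs_dotProduct_mulVec_le S x
    have hxx : 0 ≤ x ⬝ᵥ x := by
      simp only [dotProduct]; exact Finset.sum_nonneg fun l _ => mul_self_nonneg (x l)
    have h1 : |t * (x ⬝ᵥ (S *ᵥ x))| ≤ x ⬝ᵥ x := by
      rw [abs_mul]
      calc |t| * |x ⬝ᵥ (S *ᵥ x)| ≤ |t| * ((∑ j, ∑ k, |S j k|) * (x ⬝ᵥ x)) :=
            mul_le_mul_of_nonneg_left hq (abs_nonneg t)
        _ = (|t| * ∑ j, ∑ k, |S j k|) * (x ⬝ᵥ x) := by ring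
        _ ≤ 1 * (x ⬝ᵥ x) := mul_le_mul_of_nonneg_right ht hxx
        _ = x ⬝ᵥ x := one_mul _
    have h2 := neg_abs_le (t * (x ⬝ᵥ (S *ᵥ x)))
    linarith

/-- **Quadratic rigidity.** For `C ∈ ext Cor(n,m)` and a `C`-system `w = (u; v)` with Gram matrix
`G`, a symmetric `D` with zero diagonal and `ker`-condition "`Σ t_i w_i = 0 ⇒ Dt = 0`" vanishes:
writing `D = USUᵀ` in orthonormal coordinates `U` of `span{w_i}`, `G ± tD = U(I ± tS)Uᵀ` are, for
small `t > 0`, Gram matrices of unit vectors whose cross blocks give points `C ± tD_{uv} ∈ Cor(n,m)`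
with midpoint `C`; extremality and the Gram rigidity `inner_elim_eq_of_isCSystem` force `D = 0`
(the argument of Li–Tam for extreme points of the elliptope, run inside `Cor`). [folklore] -/
private theorem gram_perturbation_eq_zero {N : ℕ} {C : Matrix (Fin n) (Fin m) ℝ} (hn : 0 < n)
    (hm : 0 < m) (hC : C ∈ Set.extremePoints ℝ (quantumCorrelations n m))
    {u : Fin n → EuclideanSpace ℝ (Fin N)} {v : Fin m → EuclideanSpace ℝ (Fin N)}
    (h : IsCSystem C u v) (D : Matrix (Fin n ⊕ Fin m) (Fin n ⊕ Fin m) ℝ) (hDsymm : Dᵀ = D)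
    (hDdiag : ∀ i, D i i = 0)
    (hDker : ∀ t : Fin n ⊕ Fin m → ℝ, ∑ i, t i • Sum.elim u v i = 0 → D *ᵥ t = 0) :
    D = 0 := by
  classical
  -- notation
  set w : Fin n ⊕ Fin m → EuclideanSpace ℝ (Fin N) := Sum.elim u v with hw
  have hw1 : ∀ i, ‖w i‖ = 1 := by
    obtain ⟨hu1, hv1⟩ := norm_eq_one_of_isCSystem hn hm hC h
    intro i; cases i with
    | inl x => exact hu1 x
    | inr y => exact hv1 y
  set V : Submodule ℝ (EuclideanSpace ℝ (Fin N)) := Submodule.span ℝ (Set.range w) with hV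
  have hwV : ∀ i, w i ∈ V := fun i => Submodule.subset_span ⟨i, rfl⟩
  let b := stdOrthonormalBasis ℝ V
  -- coordinates of the `w_i`
  let U : Matrix (Fin n ⊕ Fin m) (Fin (Module.finrank ℝ V)) ℝ :=
    Matrix.of fun i j => inner ℝ ((b j : V) : EuclideanSpace ℝ (Fin N)) (w i)
  have hUU : ∀ i i', ∑ j, U i j * U i' j = inner ℝ (w i) (w i') := fun i i' => by
    have hP := b.sum_inner_mul_inner (⟨w i, hwV i⟩ : V) ⟨w i', hwV i'⟩
    simp only [Submodule.coe_inner] at hP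
    rw [← hP]
    refine Finset.sum_congr rfl fun j _ => ?_
    simp only [U, Matrix.of_apply]
    rw [real_inner_comm (w i)]
  have hexp : ∀ i, ∑ j, U i j • ((b j : V) : EuclideanSpace ℝ (Fin N)) = w i := fun i => by
    have hr := b.sum_repr' (⟨w i, hwV i⟩ : V)
    have hr' := congrArg Subtype.val hr
    simp only [Submodule.coe_sum, Submodule.coe_smul, Submodule.coe_inner] at hr'
    simpa only [U, Matrix.of_apply] using hr'
  -- the basis vectors as combinations of the `w_i`
  have hβ : ∀ j, ∃ β : Fin n ⊕ Fin m → ℝ, ∑ i, β i • w i = ((b j : V) : EuclideanSpace ℝ (Fin N)) :=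
    fun j => (Submodule.mem_span_range_iff_exists_fun ℝ).mp (b j).2
  choose β hβ using hβ
  let βM : Matrix (Fin (Module.finrank ℝ V)) (Fin n ⊕ Fin m) ℝ := Matrix.of β
  let γ : Matrix (Fin n ⊕ Fin m) (Fin n ⊕ Fin m) ℝ := U * βM
  have hγ : ∀ i, ∑ p, γ i p • w p = w i := fun i => by
    have h1 : ∀ p, γ i p • w p = ∑ j, (U i j * β j p) • w p := fun p => by
      simp only [γ, βM, Matrix.mul_apply, Matrix.of_apply, Finset.sum_smul]
    simp only [h1]
    rw [Finset.sum_comm]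
    simp only [mul_smul, ← Finset.smul_sum, hβ]
    exact hexp i
  -- `D γᵀ = D`
  have hDγ : D * γᵀ = D := by
    ext p i
    have ht : ∑ q, (γ i q - if q = i then (1 : ℝ) else 0) • w q = 0 := by
      simp only [sub_smul, Finset.sum_sub_distrib, hγ i, ite_smul, one_smul, zero_smul,
        Finset.sum_ite_eq', Finset.mem_univ, if_true, sub_self]
    have hk := congrFun (hDker _ ht) p
    simp only [mulVec, dotProduct, Pi.zero_apply, mul_sub, Finset.sum_sub_distrib, mul_ite, mul_one,
      mul_zero, Finset.sum_ite_eq', Finset.mem_univ, if_true, sub_eq_zero] at hk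
    rw [Matrix.mul_apply]
    simpa only [Matrix.transpose_apply] using hk
  set S : Matrix (Fin (Module.finrank ℝ V)) (Fin (Module.finrank ℝ V)) ℝ := βM * D * βMᵀ with hS
  have hSsymm : Sᵀ = S := by
    rw [hS, transpose_mul, transpose_mul, transpose_transpose, hDsymm, Matrix.mul_assoc]
  have hUSU : U * S * Uᵀ = D := by
    have h1 : U * S * Uᵀ = γ * D * γᵀ := by
      simp only [hS, γ, transpose_mul, Matrix.mul_assoc]
    have h2 : γ * D = D := by
      have h3 := congrArg transpose hDγ
      rw [transpose_mul, transpose_transpose, hDsymm] at h3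
      exact h3
    rw [h1, Matrix.mul_assoc, hDγ, h2]
  have hUUt : ∀ i i', (U * Uᵀ) i i' = inner ℝ (w i) (w i') := fun i i' => by
    rw [Matrix.mul_apply]; simpa only [Matrix.transpose_apply] using hUU i i'
  -- the perturbation parameter
  obtain ⟨t, ht⟩ : ∃ t : ℝ, t = 1 / (1 + ∑ j, ∑ k, |S j k|) := ⟨_, rfl⟩
  have hsum : 0 ≤ ∑ j, ∑ k, |S j k| :=
    Finset.sum_nonneg fun j _ => Finset.sum_nonneg fun k _ => abs_nonneg _
  have ht0 : 0 < t := by rw [ht]; positivity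
  have htS : |t| * ∑ j, ∑ k, |S j k| ≤ 1 := by
    rw [abs_of_pos ht0, ht, div_mul_eq_mul_div, one_mul, div_le_one (by positivity)]
    linarith
  -- `X := G + tD = U (I + tS) Uᵀ` is psd with unit diagonal
  set X : Matrix (Fin n ⊕ Fin m) (Fin n ⊕ Fin m) ℝ :=
    Matrix.of (fun i i' => inner ℝ (w i) (w i')) + t • D with hX
  have hXeq : X = U * (1 + t • S) * Uᵀ := by
    rw [Matrix.mul_add, Matrix.add_mul, Matrix.mul_one, Matrix.mul_smul, Matrix.smul_mul, hUSU, hX]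
    congr 1
    ext i i'
    rw [Matrix.of_apply, hUUt]
  have hXpsd : X.PosSemidef := by
    rw [hXeq]
    have h1 := (posSemidef_one_add_smul_of_small S hSsymm htS).mul_mul_conjTranspose_same U
    rwa [conjTranspose_eq_transpose_of_trivial] at h1
  have hXdiag : ∀ i, X i i = 1 := fun i => by
    rw [hX, Matrix.add_apply, Matrix.of_apply, Matrix.smul_apply, hDdiag, smul_zero, add_zero,
      real_inner_self_eq_norm_sq, hw1, one_pow]
  -- Gram vectors of `X`: a `C'`-system with `C' = C + t D_{uv}`
  obtain ⟨z, hz⟩ := exists_gram_of_posSemidef hXpsd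
  have hz1 : ∀ i, ‖z i‖ ≤ 1 := fun i => by
    have h2 : ‖z i‖ ^ 2 = 1 := by rw [← real_inner_self_eq_norm_sq, hz, hXdiag]
    nlinarith [norm_nonneg (z i)]
  set C' : Matrix (Fin n) (Fin m) ℝ := Matrix.of fun x y => X (Sum.inl x) (Sum.inr y) with hC'
  have hsys' : IsCSystem C' (fun x => z (Sum.inl x)) (fun y => z (Sum.inr y)) :=
    ⟨fun x => hz1 _, fun y => hz1 _, fun x y => by rw [hC', Matrix.of_apply, hz]⟩
  -- and the mirror system for `C'' = C − t D_{uv}`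
  set X' : Matrix (Fin n ⊕ Fin m) (Fin n ⊕ Fin m) ℝ :=
    Matrix.of (fun i i' => inner ℝ (w i) (w i')) - t • D with hX'
  have hX'eq : X' = U * (1 + (-t) • S) * Uᵀ := by
    rw [Matrix.mul_add, Matrix.add_mul, Matrix.mul_one, Matrix.mul_smul, Matrix.smul_mul, hUSU, hX',
      neg_smul, ← sub_eq_add_neg]
    congr 1
    ext i i'
    rw [Matrix.of_apply, hUUt]
  have htS' : |-t| * ∑ j, ∑ k, |S j k| ≤ 1 := by rwa [abs_neg]
  have hX'psd : X'.PosSemidef := by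
    rw [hX'eq]
    have h1 := (posSemidef_one_add_smul_of_small S hSsymm htS').mul_mul_conjTranspose_same U
    rwa [conjTranspose_eq_transpose_of_trivial] at h1
  have hX'diag : ∀ i, X' i i = 1 := fun i => by
    rw [hX', Matrix.sub_apply, Matrix.of_apply, Matrix.smul_apply, hDdiag, smul_zero, sub_zero,
      real_inner_self_eq_norm_sq, hw1, one_pow]
  obtain ⟨z', hz'⟩ := exists_gram_of_posSemidef hX'psd
  have hz'1 : ∀ i, ‖z' i‖ ≤ 1 := fun i => by
    have h2 : ‖z' i‖ ^ 2 = 1 := by rw [← real_inner_self_eq_norm_sq, hz', hX'diag]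
    nlinarith [norm_nonneg (z' i)]
  set C'' : Matrix (Fin n) (Fin m) ℝ := Matrix.of fun x y => X' (Sum.inl x) (Sum.inr y) with hC''
  have hsys'' : IsCSystem C'' (fun x => z' (Sum.inl x)) (fun y => z' (Sum.inr y)) :=
    ⟨fun x => hz'1 _, fun y => hz'1 _, fun x y => by rw [hC'', Matrix.of_apply, hz']⟩
  -- `C` is the midpoint of `C', C'' ∈ Cor`
  have hseg : C ∈ openSegment ℝ C' C'' := by
    refine ⟨1 / 2, 1 / 2, by norm_num, by norm_num, by norm_num, ?_⟩
    ext x y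
    simp only [Matrix.add_apply, Matrix.smul_apply, hC', hC'', hX, hX', Matrix.of_apply,
      Matrix.sub_apply, smul_eq_mul]
    rw [h.2.2 x y]
    simp only [hw, Sum.elim_inl, Sum.elim_inr]
    ring
  have hCeq : C' = C :=
    hC.2 (mem_quantumCorrelations_of_isCSystem hsys') (mem_quantumCorrelations_of_isCSystem hsys'')
      hseg
  rw [hCeq] at hsys'
  -- Gram rigidity: the Gram matrix `X` of the new `C`-system equals `G`, so `tD = 0`
  have hGram := inner_elim_eq_of_isCSystem hn hm hC hsys' h
  ext i j
  have hij : X i j = inner ℝ (w i) (w j) := by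
    rw [← hz]
    have := hGram i j
    cases i <;> cases j <;> simpa only [Sum.elim_inl, Sum.elim_inr, hw] using this
  rw [hX, Matrix.add_apply, Matrix.of_apply, Matrix.smul_apply, smul_eq_mul, add_eq_left] at hij
  rw [Matrix.zero_apply]
  exact (mul_eq_zero.mp hij).resolve_left ht0.ne'

/-! ### B. The operator side -/

section Operator

variable {σ : Type} [Fintype σ] [DecidableEq σ]

/-! #### B0. Hermitian contractions: `−I ⪯ A ⪯ I ⇒ A² ⪯ I` -/

/-- For Hermitian `A` with `I − A ⪰ 0` and `I + A ⪰ 0`, `I − A² = S(I − A)S` with `S = (I + A)^{1/2}`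
(a functional-calculus square root commuting with `I − A`), hence `I − A² ⪰ 0`. [folklore] -/
private theorem posSemidef_one_sub_mul_self {A : Matrix σ σ ℂ} (h1 : (1 - A).PosSemidef)
    (h2 : (1 + A).PosSemidef) : (1 - A * A).PosSemidef := by
  have hle : (0 : Matrix σ σ ℂ) ≤ 1 + A := h2.nonneg
  set S : Matrix σ σ ℂ := CFC.sqrt (1 + A) with hS
  have hSS : S * S = 1 + A := CFC.sqrt_mul_sqrt_self (1 + A) hle
  have hSsa : IsSelfAdjoint S := IsSelfAdjoint.of_nonneg (CFC.sqrt_nonneg (1 + A))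
  have hcomm : Commute (1 + A) (1 - A) := by
    change (1 + A) * (1 - A) = (1 - A) * (1 + A)
    simp only [Matrix.mul_sub, Matrix.sub_mul, Matrix.add_mul, Matrix.mul_add, Matrix.mul_one,
      Matrix.one_mul]
    abel
  have hScomm : Commute S (1 - A) := by
    rw [hS, CFC.sqrt_eq_cfc]
    exact hcomm.cfc_nnreal _
  have hstar : Sᴴ = S := by rw [← Matrix.star_eq_conjTranspose]; exact hSsa.star_eq
  have heq : 1 - A * A = S * (1 - A) * Sᴴ := by
    rw [hstar, hScomm.eq, Matrix.mul_assoc, hSS]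
    simp only [Matrix.sub_mul, Matrix.mul_add, Matrix.mul_one, Matrix.one_mul]
    abel
  rw [heq]
  exact h1.mul_mul_conjTranspose_same S

/-- For such `A`, `‖Aκ‖² ≤ ‖κ‖²` (real parts of `κ* A²κ ≤ κ*κ`). [folklore] -/
private theorem re_star_mulVec_dotProduct_mulVec_le {A : Matrix σ σ ℂ} (hA : A.IsHermitian)
    (h1 : (1 - A).PosSemidef) (h2 : (1 + A).PosSemidef) (κ : σ → ℂ) :
    (star (A *ᵥ κ) ⬝ᵥ (A *ᵥ κ)).re ≤ (star κ ⬝ᵥ κ).re := by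
  have h := (posSemidef_one_sub_mul_self h1 h2).dotProduct_mulVec_nonneg κ
  rw [Matrix.sub_mulVec, Matrix.one_mulVec, dotProduct_sub] at h
  have hre := (Complex.nonneg_iff.mp h).1
  rw [Complex.sub_re] at hre
  have hAA : star (A *ᵥ κ) ⬝ᵥ (A *ᵥ κ) = star κ ⬝ᵥ ((A * A) *ᵥ κ) := by
    rw [Matrix.star_mulVec, ← Matrix.dotProduct_mulVec, Matrix.mulVec_mulVec, hA.eq]
  rw [hAA]
  linarith

/-! #### B1. Realification `ℂ^σ → ℝ^{2|σ|}` -/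

/-- The index bijection `σ ⊕ σ ≃ Fin (|σ| + |σ|)` (plumbing). [folklore] -/
private def rIdx (σ : Type) [Fintype σ] : σ ⊕ σ ≃ Fin (Fintype.card σ + Fintype.card σ) :=
  ((Fintype.equivFin σ).sumCongr (Fintype.equivFin σ)).trans finSumFinEquiv

/-- Realification of a complex vector: real and imaginary parts, as a vector of `ℝ^{2|σ|}`; an
`ℝ`-linear map. [folklore] -/
private def realify (σ : Type) [Fintype σ] :
    (σ → ℂ) →ₗ[ℝ] EuclideanSpace ℝ (Fin (Fintype.card σ + Fintype.card σ)) where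
  toFun ξ := WithLp.toLp 2 fun k =>
    Sum.elim (fun s => (ξ s).re) (fun s => (ξ s).im) ((rIdx σ).symm k)
  map_add' ξ η := by
    ext k
    simp only [PiLp.add_apply]
    cases (rIdx σ).symm k <;> simp
  map_smul' c ξ := by
    ext k
    simp only [PiLp.smul_apply, RingHom.id_apply, smul_eq_mul]
    cases (rIdx σ).symm k <;> simp

omit [DecidableEq σ] in
/-- `⟨R ξ, R η⟩ = Re(ξ* η)`. [folklore] -/
private theorem inner_realify (ξ η : σ → ℂ) :
    inner ℝ (realify σ ξ) (realify σ η) = (star ξ ⬝ᵥ η).re := by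
  simp only [realify, LinearMap.coe_mk, AddHom.coe_mk, EuclideanSpace.inner_toLp_toLp, star_trivial,
    dotProduct]
  rw [show ∑ k, Sum.elim (fun s => (η s).re) (fun s => (η s).im) ((rIdx σ).symm k) *
        Sum.elim (fun s => (ξ s).re) (fun s => (ξ s).im) ((rIdx σ).symm k) =
      ∑ i : σ ⊕ σ, Sum.elim (fun s => (η s).re) (fun s => (η s).im) i *
        Sum.elim (fun s => (ξ s).re) (fun s => (ξ s).im) i from
    (rIdx σ).symm.sum_comp (fun i => Sum.elim (fun s => (η s).re) (fun s => (η s).im) i *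
        Sum.elim (fun s => (ξ s).re) (fun s => (ξ s).im) i)]
  rw [Fintype.sum_sum_type, Complex.re_sum, ← Finset.sum_add_distrib]
  refine Finset.sum_congr rfl fun s _ => ?_
  simp only [Sum.elim_inl, Sum.elim_inr, Pi.star_apply, Complex.star_def, Complex.mul_re,
    Complex.conj_re, Complex.conj_im]
  ring

omit [DecidableEq σ] in
/-- `‖R ξ‖² = Re(ξ*ξ)`. [folklore] -/
private theorem norm_realify_sq (ξ : σ → ℂ) : ‖realify σ ξ‖ ^ 2 = (star ξ ⬝ᵥ ξ).re := by
  rw [← real_inner_self_eq_norm_sq, inner_realify]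

omit [DecidableEq σ] in
/-- `R ξ = 0 ⇒ ξ = 0`. [folklore] -/
private theorem eq_zero_of_realify_eq_zero {ξ : σ → ℂ} (h : realify σ ξ = 0) : ξ = 0 := by
  have h2 : (star ξ ⬝ᵥ ξ).re = 0 := by rw [← norm_realify_sq, h, norm_zero]; ring
  have hnn : ∀ s, 0 ≤ (star (ξ s) * ξ s).re := fun s => by
    rw [Complex.star_def, Complex.mul_re, Complex.conj_re, Complex.conj_im]
    nlinarith [sq_nonneg (ξ s).re, sq_nonneg (ξ s).im]
  have hterm : ∀ s, (star (ξ s) * ξ s).re = 0 := by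
    have hsum : ∑ s, (star (ξ s) * ξ s).re = 0 := by
      rw [← Complex.re_sum]; simpa only [dotProduct, Pi.star_apply] using h2
    intro s
    exact (Finset.sum_eq_zero_iff_of_nonneg fun s _ => hnn s).mp hsum s (Finset.mem_univ s)
  funext s
  have h3 := hterm s
  rw [Complex.star_def, Complex.mul_re, Complex.conj_re, Complex.conj_im] at h3
  have hre : (ξ s).re = 0 := by nlinarith [sq_nonneg (ξ s).re, sq_nonneg (ξ s).im]
  have him : (ξ s).im = 0 := by nlinarith [sq_nonneg (ξ s).re, sq_nonneg (ξ s).im]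
  exact Complex.ext hre him

omit [DecidableEq σ] in
/-- Real scalars act on `ℂ^σ` through the coercion. [folklore] -/
private theorem realify_coe_smul (t : ℝ) (ξ : σ → ℂ) :
    realify σ ((t : ℂ) • ξ) = t • realify σ ξ := by
  rw [← map_smul]
  congr 1

/-! #### B2. Spectral data of a state -/

omit [DecidableEq σ] in
/-- Spectral decomposition of a Hermitian `ρ`, in the form used below: orthonormal eigenvectors
`κ_j` (columns of the eigenvector unitary) with `Tr(Xρ) = Σ_j λ_j κ_j* X κ_j` and
`ρ η = Σ_j λ_j (κ_j* η) κ_j`. [folklore] -/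
private theorem spectral_data [DecidableEq σ] {ρ : Matrix σ σ ℂ} (hρ : ρ.IsHermitian) :
    ∃ κ : σ → σ → ℂ, (∀ j, star (κ j) ⬝ᵥ κ j = 1) ∧
      (∀ X : Matrix σ σ ℂ, (X * ρ).trace = ∑ j, (hρ.eigenvalues j : ℂ) * (star (κ j) ⬝ᵥ (X *ᵥ κ j))) ∧
      ∀ η : σ → ℂ, ρ *ᵥ η = ∑ j, ((hρ.eigenvalues j : ℂ) * (star (κ j) ⬝ᵥ η)) • κ j := by
  classical
  set U : Matrix σ σ ℂ := (hρ.eigenvectorUnitary : Matrix σ σ ℂ) with hU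
  have hUU : Uᴴ * U = 1 := by
    rw [← star_eq_conjTranspose]; exact Unitary.coe_star_mul_self hρ.eigenvectorUnitary
  have hUU' : U * Uᴴ = 1 := by
    rw [← star_eq_conjTranspose]; exact Unitary.coe_mul_star_self hρ.eigenvectorUnitary
  set D : Matrix σ σ ℂ := diagonal fun j => ((hρ.eigenvalues j : ℝ) : ℂ) with hD
  let κ : σ → σ → ℂ := fun j s => U s j
  have hκ : ∀ j, κ j = ⇑(hρ.eigenvectorBasis j) := fun j => by
    funext s; simp only [κ, hU, Matrix.IsHermitian.eigenvectorUnitary_apply]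
  -- `ρ U = U D`
  have hρU : ρ * U = U * D := by
    ext s j
    have h := congrFun (hρ.mulVec_eigenvectorBasis j) s
    rw [← hκ j] at h
    simp only [Pi.smul_apply] at h
    rw [Matrix.mul_apply, hD, Matrix.mul_diagonal]
    simp only [mulVec, dotProduct, κ] at h
    rw [h, Complex.real_smul, mul_comm]
  have hρeq : ρ = U * D * Uᴴ := by
    rw [← hρU, Matrix.mul_assoc, hUU', Matrix.mul_one]
  refine ⟨κ, fun j => ?_, fun X => ?_, fun η => ?_⟩
  · -- orthonormality from `Uᴴ U = 1`
    have h := congrFun (congrFun hUU j) j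
    rw [Matrix.mul_apply, Matrix.one_apply_eq] at h
    simpa only [dotProduct, Pi.star_apply, conjTranspose_apply, κ] using h
  · have hstep : (X * ρ).trace = (X * (U * D * Uᴴ)).trace := by rw [← hρeq]
    rw [hstep, show X * (U * D * Uᴴ) = (X * U * D) * Uᴴ by simp only [Matrix.mul_assoc],
      Matrix.trace_mul_comm, ← Matrix.mul_assoc, ← Matrix.mul_assoc, Matrix.trace]
    simp only [Matrix.diag_apply, hD, Matrix.mul_diagonal]
    refine Finset.sum_congr rfl fun j _ => ?_
    rw [mul_comm, Matrix.mul_apply]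
    congr 1
    simp only [dotProduct, mulVec, Pi.star_apply, Matrix.mul_apply, conjTranspose_apply, κ,
      Finset.mul_sum, Finset.sum_mul]
    rw [Finset.sum_comm]
    exact Finset.sum_congr rfl fun s _ => Finset.sum_congr rfl fun s' _ => by ring
  · have hstep : ρ *ᵥ η = (U * D * Uᴴ) *ᵥ η := by rw [← hρeq]
    rw [hstep, ← mulVec_mulVec, ← mulVec_mulVec]
    funext s
    simp only [mulVec, dotProduct, Finset.sum_apply, Pi.smul_apply, smul_eq_mul, hD,
      diagonal_apply, conjTranspose_apply, κ, Pi.star_apply]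
    refine Finset.sum_congr rfl fun j _ => ?_
    rw [Finset.sum_eq_single j (fun k _ hk => by rw [if_neg (Ne.symm hk), zero_mul]) (by simp),
      if_pos rfl]
    ring

/-! #### B3. The cyclic hull of the support: invariant subspaces and their projectors -/

/-- The smallest subspace of `ℂ^σ` containing `K` and invariant under all `B_y` (the `B`-cyclic hull
of `K`; plumbing for the proof of Theorem 20). [folklore] -/
private def invHull (B : Fin m → Matrix σ σ ℂ) (K : Set (σ → ℂ)) : Submodule ℂ (σ → ℂ) :=
  ⨅ (W : Submodule ℂ (σ → ℂ)) (_ : K ⊆ W ∧ ∀ y, ∀ ξ ∈ W, B y *ᵥ ξ ∈ W), W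

omit [DecidableEq σ] in
/-- The hull contains `K`. [folklore] -/
private theorem subset_invHull (B : Fin m → Matrix σ σ ℂ) (K : Set (σ → ℂ)) :
    K ⊆ invHull B K := fun ξ hξ => by
  simp only [invHull, SetLike.mem_coe, Submodule.mem_iInf]
  exact fun W hW => hW.1 hξ

omit [DecidableEq σ] in
/-- The hull is `B_y`-invariant. [folklore] -/
private theorem mulVec_mem_invHull (B : Fin m → Matrix σ σ ℂ) (K : Set (σ → ℂ)) (y : Fin m)
    {ξ : σ → ℂ} (hξ : ξ ∈ invHull B K) : B y *ᵥ ξ ∈ invHull B K := by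
  simp only [invHull, Submodule.mem_iInf] at hξ ⊢
  exact fun W hW => hW.2 y ξ (hξ W hW)

omit [DecidableEq σ] in
/-- Minimality of the hull. [folklore] -/
private theorem invHull_le (B : Fin m → Matrix σ σ ℂ) (K : Set (σ → ℂ)) {W : Submodule ℂ (σ → ℂ)}
    (hK : K ⊆ W) (hW : ∀ y, ∀ ξ ∈ W, B y *ᵥ ξ ∈ W) : invHull B K ≤ W :=
  iInf₂_le W ⟨hK, hW⟩

omit [DecidableEq σ] in
/-- An operator commuting with every `B_y` and killing `K` kills the hull. [folklore] -/
private theorem mulVec_eq_zero_of_mem_invHull (B : Fin m → Matrix σ σ ℂ) (K : Set (σ → ℂ))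
    {Z : Matrix σ σ ℂ} (hZB : ∀ y, Z * B y = B y * Z) (hZK : ∀ ξ ∈ K, Z *ᵥ ξ = 0)
    {ξ : σ → ℂ} (hξ : ξ ∈ invHull B K) : Z *ᵥ ξ = 0 := by
  let W : Submodule ℂ (σ → ℂ) :=
    { carrier := {ξ | Z *ᵥ ξ = 0}
      add_mem' := fun {a b} ha hb => by
        simp only [Set.mem_setOf_eq] at ha hb ⊢; rw [mulVec_add, ha, hb, add_zero]
      zero_mem' := by simp only [Set.mem_setOf_eq, mulVec_zero]
      smul_mem' := fun c ξ hξ => by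
        simp only [Set.mem_setOf_eq] at hξ ⊢; rw [mulVec_smul, hξ, smul_zero] }
  have hle : invHull B K ≤ W := invHull_le B K (fun ξ hξ => hZK ξ hξ) fun y ξ hξ => by
    change Z *ᵥ (B y *ᵥ ξ) = 0
    change Z *ᵥ ξ = 0 at hξ
    rw [mulVec_mulVec, hZB, ← mulVec_mulVec, hξ, mulVec_zero]
  exact hle hξ

omit [DecidableEq σ] in
/-- If `A_x K ⊆ hull` and the `A_x` commute with the `B_y`, the hull is `A_x`-invariant. [folklore] -/
private theorem mulVec_mem_invHull_of_comm (B : Fin m → Matrix σ σ ℂ) (K : Set (σ → ℂ))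
    {A : Matrix σ σ ℂ} (hAB : ∀ y, A * B y = B y * A) (hAK : ∀ ξ ∈ K, A *ᵥ ξ ∈ invHull B K)
    {ξ : σ → ℂ} (hξ : ξ ∈ invHull B K) : A *ᵥ ξ ∈ invHull B K := by
  let W : Submodule ℂ (σ → ℂ) :=
    { carrier := {ξ | ξ ∈ invHull B K ∧ A *ᵥ ξ ∈ invHull B K}
      add_mem' := fun {a b} ha hb =>
        ⟨Submodule.add_mem _ ha.1 hb.1, by rw [mulVec_add]; exact Submodule.add_mem _ ha.2 hb.2⟩
      zero_mem' := ⟨Submodule.zero_mem _, by rw [mulVec_zero]; exact Submodule.zero_mem _⟩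
      smul_mem' := fun c ξ hξ =>
        ⟨Submodule.smul_mem _ c hξ.1, by rw [mulVec_smul]; exact Submodule.smul_mem _ c hξ.2⟩ }
  have hle : invHull B K ≤ W := invHull_le B K
    (fun ξ hξ => ⟨subset_invHull B K hξ, hAK ξ hξ⟩) fun y ξ hξ => by
      refine ⟨mulVec_mem_invHull B K y hξ.1, ?_⟩
      rw [mulVec_mulVec, hAB, ← mulVec_mulVec]
      exact mulVec_mem_invHull B K y hξ.2
  exact (hle hξ).2

omit [DecidableEq σ] in
/-- The orthogonal projector onto a subspace `M ⊆ ℂ^σ` as a matrix: Hermitian, idempotent, fixing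
`M` pointwise, with range in `M`. (Columns of an orthonormal basis of `M`.) [folklore] -/
private theorem exists_projector [DecidableEq σ] (M : Submodule ℂ (σ → ℂ)) :
    ∃ P : Matrix σ σ ℂ, P.IsHermitian ∧ P * P = P ∧ (∀ ξ ∈ M, P *ᵥ ξ = ξ) ∧ ∀ η, P *ᵥ η ∈ M := by
  classical
  -- transport `M` into `EuclideanSpace ℂ σ` and take an orthonormal basis
  let M' : Submodule ℂ (EuclideanSpace ℂ σ) := M.comap (WithLp.linearEquiv 2 ℂ (σ → ℂ)).toLinearMap
  have hM' : ∀ v : EuclideanSpace ℂ σ, v ∈ M' ↔ (v : σ → ℂ) ∈ M := fun v => Iff.rfl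
  let b := stdOrthonormalBasis ℂ M'
  let Q : Matrix σ (Fin (Module.finrank ℂ M')) ℂ :=
    Matrix.of fun s a => ((b a : M') : EuclideanSpace ℂ σ) s
  have hQQ : Qᴴ * Q = 1 := by
    ext a c
    have h := orthonormal_iff_ite.mp b.orthonormal a c
    rw [Submodule.coe_inner] at h
    have h' : ∑ s, star (((b a : M') : EuclideanSpace ℂ σ) s) * ((b c : M') : EuclideanSpace ℂ σ) s =
        if a = c then 1 else 0 := by
      simpa [PiLp.inner_apply, mul_comm] using h
    rw [Matrix.mul_apply, Matrix.one_apply, ← h']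
    simp only [Q, conjTranspose_apply, of_apply]
  have hfix : ∀ v : EuclideanSpace ℂ σ, v ∈ M' → (Q * Qᴴ) *ᵥ (v : σ → ℂ) = v := by
    intro v hv
    funext s
    have h := b.sum_repr' ⟨v, hv⟩
    have h2 := congrArg (fun w : M' => (w : EuclideanSpace ℂ σ) s) h
    simp only [Submodule.coe_sum, Submodule.coe_smul, Submodule.coe_inner] at h2
    have h3 : ∑ a, (inner ℂ ((b a : M') : EuclideanSpace ℂ σ) v) *
        ((b a : M') : EuclideanSpace ℂ σ) s = v s := by
      simpa [WithLp.ofLp_sum, Finset.sum_apply, smul_eq_mul] using h2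
    rw [← mulVec_mulVec]
    change _ = v s
    rw [← h3]
    simp only [mulVec, dotProduct, Q, conjTranspose_apply, of_apply]
    refine Finset.sum_congr rfl fun a _ => ?_
    rw [mul_comm]
    congr 1
    simp [PiLp.inner_apply, mul_comm]
  refine ⟨Q * Qᴴ, ?_, ?_, fun ξ hξ => ?_, fun η => ?_⟩
  · rw [IsHermitian, conjTranspose_mul, conjTranspose_conjTranspose]
  · rw [Matrix.mul_assoc, ← Matrix.mul_assoc Qᴴ, hQQ, Matrix.one_mul]
  · exact hfix (WithLp.toLp 2 ξ) ((hM' _).mpr hξ)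
  · -- `Q Qᴴ η = Σ_a (Qᴴη)_a • b_a ∈ M`
    rw [← mulVec_mulVec]
    have hcomb : Q *ᵥ (Qᴴ *ᵥ η) = ∑ a, (Qᴴ *ᵥ η) a • (((b a : M') : EuclideanSpace ℂ σ) : σ → ℂ) := by
      funext s
      simp only [mulVec, dotProduct, Finset.sum_apply, Pi.smul_apply, smul_eq_mul, Q, of_apply]
      refine Finset.sum_congr rfl fun a _ => ?_
      simp only [conjTranspose_apply, of_apply]
      ring
    rw [hcomb]
    refine Submodule.sum_mem _ fun a _ => Submodule.smul_mem _ _ ?_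
    exact (hM' _).mp (b a).2

omit [DecidableEq σ] in
/-- Two matrices with the same action on vectors are equal. [folklore] -/
private theorem ext_of_mulVec [DecidableEq σ] {M₁ M₂ : Matrix σ σ ℂ} (h : ∀ v, M₁ *ᵥ v = M₂ *ᵥ v) :
    M₁ = M₂ := by
  ext i j
  have := congrFun (h (Pi.single j 1)) i
  rwa [Matrix.mulVec_single_one, Matrix.mulVec_single_one] at this


/-! #### B4. The `A`-side of Theorem 20 -/

/-- **Theorem 20, `A`-side.** Under the hypotheses of `Tsirelson1987_thm20`,
`{A_x, A_{x'}} = 2⟨u_x, u_{x'}⟩ I` for every `C`-system `(u, v)`. Steps (see the module docstring):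
pure components `κ_j` of `ρ` give `C`-systems `(A_xκ_j, B_yκ_j)` of `C` itself (extremality);
Gram rigidity transfers linear relations of `(u,v)` to the operators on `κ_j` and gives
`A_x²κ_j = κ_j`; the `B`-cyclic hull of the `κ_j` is `A`-invariant hence everything (condition (v));
quadratic rigidity (`gram_perturbation_eq_zero`) gives `{A_x,A_{x'}}κ_j = 2⟨u_x,u_{x'}⟩κ_j`, and an
element of the `A`-algebra killing every `κ_j` is zero. [folklore] -/
private theorem anticommutator_eq_of_extreme (hn : 0 < n) (hm : 0 < m) {C : Matrix (Fin n) (Fin m) ℝ}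
    (hC : C ∈ Set.extremePoints ℝ (quantumCorrelations n m))
    (A : Fin n → Matrix σ σ ℂ) (B : Fin m → Matrix σ σ ℂ) (ρ : Matrix σ σ ℂ)
    (hCtr : ∀ x y, ((C x y : ℝ) : ℂ) = (A x * B y * ρ).trace)
    (hcomm : ∀ x y, A x * B y = B y * A x) (hρ : ρ.PosSemidef) (hρ1 : ρ.trace = 1)
    (hA : ∀ x, (A x).IsHermitian ∧ (1 - A x).PosSemidef ∧ (1 + A x).PosSemidef)
    (hB : ∀ y, (B y).IsHermitian ∧ (1 - B y).PosSemidef ∧ (1 + B y).PosSemidef)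
    (hirr : ¬ ∃ P : Matrix σ σ ℂ, P.IsHermitian ∧ P * P = P ∧ P ≠ 1 ∧
          (∀ x, P * A x = A x * P) ∧ (∀ y, P * B y = B y * P) ∧ P * ρ * P = ρ)
    {N : ℕ} {u : Fin n → EuclideanSpace ℝ (Fin N)} {v : Fin m → EuclideanSpace ℝ (Fin N)}
    (huv : IsCSystem C u v) (x₁ x₂ : Fin n) :
    A x₁ * A x₂ + A x₂ * A x₁ = ((2 * inner ℝ (u x₁) (u x₂) : ℝ) : ℂ) • 1 := by
  classical
  /- spectral data of `ρ` -/
  obtain ⟨κ, hκ1, htr, hρv⟩ := spectral_data hρ.1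
  set lam : σ → ℝ := hρ.1.eigenvalues with hlam
  have hlam0 : ∀ j, 0 ≤ lam j := fun j => hρ.eigenvalues_nonneg j
  have hlam1 : ∑ j, lam j = 1 := by
    have h := hρ.1.trace_eq_sum_eigenvalues
    rw [hρ1] at h
    have h2 : ((∑ j, lam j : ℝ) : ℂ) = 1 := by rw [Complex.ofReal_sum]; exact h.symm
    exact_mod_cast h2
  /- pure-state correlations and their `C`-systems -/
  let Cp : σ → Matrix (Fin n) (Fin m) ℝ := fun j =>
    Matrix.of fun x y => (star (A x *ᵥ κ j) ⬝ᵥ (B y *ᵥ κ j)).re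
  have hsys : ∀ j, IsCSystem (Cp j) (fun x => realify σ (A x *ᵥ κ j))
      (fun y => realify σ (B y *ᵥ κ j)) := by
    intro j
    refine ⟨fun x => ?_, fun y => ?_, fun x y => by rw [inner_realify]; rfl⟩
    · have h2 : ‖realify σ (A x *ᵥ κ j)‖ ^ 2 ≤ 1 := by
        rw [norm_realify_sq]
        have := re_star_mulVec_dotProduct_mulVec_le (hA x).1 (hA x).2.1 (hA x).2.2 (κ j)
        rwa [hκ1 j, Complex.one_re] at this
      nlinarith [norm_nonneg (realify σ (A x *ᵥ κ j))]
    · have h2 : ‖realify σ (B y *ᵥ κ j)‖ ^ 2 ≤ 1 := by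
        rw [norm_realify_sq]
        have := re_star_mulVec_dotProduct_mulVec_le (hB y).1 (hB y).2.1 (hB y).2.2 (κ j)
        rwa [hκ1 j, Complex.one_re] at this
      nlinarith [norm_nonneg (realify σ (B y *ᵥ κ j))]
  have hCp : ∀ j, Cp j ∈ quantumCorrelations n m := fun j =>
    mem_quantumCorrelations_of_isCSystem (hsys j)
  /- `C = Σ_j λ_j C(κ_j)` -/
  have hdec : ∑ j, lam j • Cp j = C := by
    ext x y
    have h := congrArg Complex.re (hCtr x y)
    rw [Complex.ofReal_re, htr (A x * B y), Complex.re_sum] at h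
    rw [h, Matrix.sum_apply]
    refine Finset.sum_congr rfl fun j _ => ?_
    rw [Matrix.smul_apply, smul_eq_mul, Complex.re_ofReal_mul]
    congr 1
    simp only [Cp, Matrix.of_apply]
    rw [Matrix.star_mulVec, ← Matrix.dotProduct_mulVec, Matrix.mulVec_mulVec, (hA x).1.eq]
  /- extremality: every positively weighted pure correlation is `C` -/
  have hCpC : ∀ j, 0 < lam j → Cp j = C := fun j hj =>
    eq_of_mem_extremePoints_of_sum_smul convex_quantumCorrelations hC Finset.univ lam Cp
      (fun j _ => hlam0 j) hlam1 (fun j _ => hCp j) hdec j (Finset.mem_univ j) hj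
  have hsysC : ∀ j, 0 < lam j →
      IsCSystem C (fun x => realify σ (A x *ᵥ κ j)) (fun y => realify σ (B y *ᵥ κ j)) :=
    fun j hj => hCpC j hj ▸ hsys j
  /- transfer of linear relations from `(u, v)` to the operators on `κ_j` -/
  have htransfer : ∀ j, 0 < lam j → ∀ (t : Fin n → ℝ) (s : Fin m → ℝ),
      ∑ x, t x • u x + ∑ y, s y • v y = 0 →
      ∑ x, t x • (A x *ᵥ κ j) + ∑ y, s y • (B y *ᵥ κ j) = 0 := by
    intro j hj t s hts
    have hG := inner_elim_eq_of_isCSystem hn hm hC huv (hsysC j hj)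
    have hnorm := norm_sum_smul_eq_of_inner_eq (Sum.elim u v)
      (Sum.elim (fun x => realify σ (A x *ᵥ κ j)) (fun y => realify σ (B y *ᵥ κ j))) hG
      (Sum.elim t s)
    simp only [Fintype.sum_sum_type, Sum.elim_inl, Sum.elim_inr, hts, norm_zero] at hnorm
    have h0 : ∑ x, t x • realify σ (A x *ᵥ κ j) + ∑ y, s y • realify σ (B y *ᵥ κ j) = 0 :=
      norm_eq_zero.mp hnorm.symm
    apply eq_zero_of_realify_eq_zero (σ := σ)
    rw [map_add, map_sum, map_sum]
    simpa only [map_smul] using h0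
  /- Lemma 12: coefficients `u_x = Σ_y λ_{xy} v_y`, `v_y = Σ_x μ_{yx} u_x` -/
  have hspan := (Tsirelson1987_lemma12_holds n m C hn hm hC).1 N u v huv
  have hlamb : ∀ x, ∃ c : Fin m → ℝ, ∑ y, c y • v y = u x := fun x =>
    (Submodule.mem_span_range_iff_exists_fun ℝ).mp (hspan ▸ Submodule.subset_span ⟨x, rfl⟩)
  choose cl hcl using hlamb
  have hspan' := (Tsirelson1987_lemma12_holds m n Cᵀ hm hn
    (transpose_mem_extremePoints_quantumCorrelations hC)).1 N v u huv.transpose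
  have hmu : ∀ y, ∃ c : Fin n → ℝ, ∑ x, c x • u x = v y := fun y =>
    (Submodule.mem_span_range_iff_exists_fun ℝ).mp (hspan' ▸ Submodule.subset_span ⟨y, rfl⟩)
  choose cm hcm using hmu
  let L : Fin n → Matrix σ σ ℂ := fun x => ∑ y, cl x y • B y
  let Mo : Fin m → Matrix σ σ ℂ := fun y => ∑ x, cm y x • A x
  have hAL : ∀ j, 0 < lam j → ∀ x, A x *ᵥ κ j = L x *ᵥ κ j := by
    intro j hj x
    have hrel : ∑ x', (if x' = x then (1 : ℝ) else 0) • u x' + ∑ y, (-cl x y) • v y = 0 := by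
      simp only [ite_smul, one_smul, zero_smul, Finset.sum_ite_eq', Finset.mem_univ, if_true,
        neg_smul, Finset.sum_neg_distrib, hcl x, add_neg_cancel]
    have h := htransfer j hj _ _ hrel
    simp only [ite_smul, one_smul, zero_smul, Finset.sum_ite_eq', Finset.mem_univ, if_true,
      neg_smul, Finset.sum_neg_distrib, ← sub_eq_add_neg, sub_eq_zero] at h
    rw [h]
    simp only [L, Matrix.sum_mulVec, Matrix.smul_mulVec]
  have hBM : ∀ j, 0 < lam j → ∀ y, B y *ᵥ κ j = Mo y *ᵥ κ j := by
    intro j hj y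
    have hrel : ∑ x, (-cm y x) • u x + ∑ y', (if y' = y then (1 : ℝ) else 0) • v y' = 0 := by
      simp only [ite_smul, one_smul, zero_smul, Finset.sum_ite_eq', Finset.mem_univ, if_true,
        neg_smul, Finset.sum_neg_distrib, hcm y, neg_add_cancel]
    have h := htransfer j hj _ _ hrel
    simp only [ite_smul, one_smul, zero_smul, Finset.sum_ite_eq', Finset.mem_univ, if_true,
      neg_smul, Finset.sum_neg_distrib, neg_add_eq_zero] at h
    rw [← h]
    simp only [Mo, Matrix.sum_mulVec, Matrix.smul_mulVec]
  /- unit norms: `A_x² κ_j = κ_j`, `B_y² κ_j = κ_j` -/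
  have hsq : ∀ {X : Matrix σ σ ℂ}, X.IsHermitian → (1 - X).PosSemidef → (1 + X).PosSemidef →
      ∀ j, ‖realify σ (X *ᵥ κ j)‖ = 1 → X *ᵥ (X *ᵥ κ j) = κ j := by
    intro X hX h1 h2 j hnorm1
    have h2' : (star (X *ᵥ κ j) ⬝ᵥ (X *ᵥ κ j)).re = 1 := by
      rw [← norm_realify_sq, hnorm1, one_pow]
    have hXX : star (X *ᵥ κ j) ⬝ᵥ (X *ᵥ κ j) = star (κ j) ⬝ᵥ ((X * X) *ᵥ κ j) := by
      rw [Matrix.star_mulVec, ← Matrix.dotProduct_mulVec, Matrix.mulVec_mulVec, hX.eq]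
    have hpsd := posSemidef_one_sub_mul_self h1 h2
    have h3 : star (κ j) ⬝ᵥ ((1 - X * X) *ᵥ κ j) = 0 := by
      have hnn := hpsd.dotProduct_mulVec_nonneg (κ j)
      obtain ⟨-, him⟩ := Complex.nonneg_iff.mp hnn
      apply Complex.ext
      · rw [Matrix.sub_mulVec, Matrix.one_mulVec, dotProduct_sub, Complex.sub_re, hκ1 j, ← hXX, h2',
          Complex.one_re, sub_self, Complex.zero_re]
      · rw [← him, Complex.zero_im]
    have h4 := (hpsd.dotProduct_mulVec_zero_iff (κ j)).mp h3
    rw [Matrix.sub_mulVec, Matrix.one_mulVec, sub_eq_zero, ← Matrix.mulVec_mulVec] at h4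
    exact h4.symm
  have hAA : ∀ j, 0 < lam j → ∀ x, A x *ᵥ (A x *ᵥ κ j) = κ j := fun j hj x =>
    hsq (hA x).1 (hA x).2.1 (hA x).2.2 j ((norm_eq_one_of_isCSystem hn hm hC (hsysC j hj)).1 x)
  have hBB : ∀ j, 0 < lam j → ∀ y, B y *ᵥ (B y *ᵥ κ j) = κ j := fun j hj y =>
    hsq (hB y).1 (hB y).2.1 (hB y).2.2 j ((norm_eq_one_of_isCSystem hn hm hC (hsysC j hj)).2 y)
  /- the `B`-cyclic hull of the support is everything -/
  set K : Set (σ → ℂ) := {ξ | ∃ j, 0 < lam j ∧ κ j = ξ} with hK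
  have hκM : ∀ j, 0 < lam j → κ j ∈ invHull B K := fun j hj => subset_invHull B K ⟨j, hj, rfl⟩
  have hAM : ∀ x, ∀ ξ ∈ invHull B K, A x *ᵥ ξ ∈ invHull B K := fun x ξ hξ =>
    mulVec_mem_invHull_of_comm B K (hcomm x) (fun ξ' hξ' => by
      obtain ⟨j, hj, rfl⟩ := hξ'
      rw [hAL j hj x]
      simp only [L, Matrix.sum_mulVec, Matrix.smul_mulVec]
      exact Submodule.sum_mem _ fun y _ =>
        Submodule.smul_of_tower_mem _ _ (mulVec_mem_invHull B K y (hκM j hj))) hξ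
  have hMtop : ∀ ξ, ξ ∈ invHull B K := by
    obtain ⟨P, hPh, hPP, hPfix, hPmem⟩ := exists_projector (invHull B K)
    by_contra hnot
    push Not at hnot
    obtain ⟨ξ, hξ⟩ := hnot
    apply hirr
    refine ⟨P, hPh, hPP, fun hP1 => ?_, fun x => ?_, fun y => ?_, ?_⟩
    · apply hξ
      have := hPmem ξ
      rwa [hP1, Matrix.one_mulVec] at this
    · have hPAP : P * A x * P = A x * P := ext_of_mulVec fun η => by
        rw [← Matrix.mulVec_mulVec, ← Matrix.mulVec_mulVec, ← Matrix.mulVec_mulVec]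
        exact hPfix _ (hAM x _ (hPmem η))
      calc P * A x = (A x * P)ᴴ := by rw [conjTranspose_mul, hPh.eq, (hA x).1.eq]
        _ = (P * A x * P)ᴴ := by rw [hPAP]
        _ = P * A x * P := by
          rw [conjTranspose_mul, conjTranspose_mul, hPh.eq, (hA x).1.eq, Matrix.mul_assoc]
        _ = A x * P := hPAP
    · have hPBP : P * B y * P = B y * P := ext_of_mulVec fun η => by
        rw [← Matrix.mulVec_mulVec, ← Matrix.mulVec_mulVec, ← Matrix.mulVec_mulVec]
        exact hPfix _ (mulVec_mem_invHull B K y (hPmem η))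
      calc P * B y = (B y * P)ᴴ := by rw [conjTranspose_mul, hPh.eq, (hB y).1.eq]
        _ = (P * B y * P)ᴴ := by rw [hPBP]
        _ = P * B y * P := by
          rw [conjTranspose_mul, conjTranspose_mul, hPh.eq, (hB y).1.eq, Matrix.mul_assoc]
        _ = B y * P := hPBP
    · have hPρ : P * ρ = ρ := ext_of_mulVec fun η => by
        rw [← Matrix.mulVec_mulVec, hρv η, Matrix.mulVec_sum]
        refine Finset.sum_congr rfl fun j _ => ?_
        rw [Matrix.mulVec_smul]
        by_cases hj : 0 < lam j
        · rw [hPfix _ (hκM j hj)]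
        · have h0 : lam j = 0 := le_antisymm (not_lt.mp hj) (hlam0 j)
          rw [h0]
          simp
      calc P * ρ * P = ρ * P := by rw [hPρ]
        _ = (P * ρ)ᴴ := by rw [conjTranspose_mul, hPh.eq, hρ.1.eq]
        _ = ρ := by rw [hPρ, hρ.1.eq]
  have hkill : ∀ Z : Matrix σ σ ℂ, (∀ y, Z * B y = B y * Z) → (∀ j, 0 < lam j → Z *ᵥ κ j = 0) →
      Z = 0 := by
    intro Z hZB hZκ
    refine ext_of_mulVec fun η => ?_
    rw [Matrix.zero_mulVec]
    exact mulVec_eq_zero_of_mem_invHull B K hZB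
      (fun ξ hξ => by obtain ⟨j, hj, rfl⟩ := hξ; exact hZκ j hj) (hMtop η)
  /- the operator family `W = (A_x; M_y)` mirroring `w = (u_x; v_y)` -/
  let W : Fin n ⊕ Fin m → Matrix σ σ ℂ := Sum.elim A Mo
  have hMoB : ∀ y y', Mo y * B y' = B y' * Mo y := fun y y' => by
    simp only [Mo, Finset.sum_mul, Finset.mul_sum, smul_mul_assoc, mul_smul_comm, hcomm]
  have hWB : ∀ i y, W i * B y = B y * W i := by
    intro i y
    cases i with
    | inl x => exact hcomm x y
    | inr y' => exact hMoB y' y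
  have hWw : ∀ j, 0 < lam j → ∀ i, realify σ (W i *ᵥ κ j) =
      Sum.elim (fun x => realify σ (A x *ᵥ κ j)) (fun y => realify σ (B y *ᵥ κ j)) i := by
    intro j hj i
    cases i with
    | inl x => rfl
    | inr y => simp only [W, Sum.elim_inr]; rw [← hBM j hj y]
  have hWW : ∀ j, 0 < lam j → ∀ i, W i *ᵥ (W i *ᵥ κ j) = κ j := by
    intro j hj i
    cases i with
    | inl x => exact hAA j hj x
    | inr y =>
      simp only [W, Sum.elim_inr]
      rw [← hBM j hj y, Matrix.mulVec_mulVec, hMoB, ← Matrix.mulVec_mulVec, ← hBM j hj y]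
      exact hBB j hj y
  have hWt : ∀ t : Fin n ⊕ Fin m → ℝ, ∑ i, t i • Sum.elim u v i = 0 → ∑ i, t i • W i = 0 := by
    intro t ht
    refine hkill _ (fun y => ?_) fun j hj => ?_
    · simp only [Finset.sum_mul, Finset.mul_sum, smul_mul_assoc, mul_smul_comm, hWB]
    · rw [Matrix.sum_mulVec]
      simp only [Matrix.smul_mulVec, Fintype.sum_sum_type, W, Sum.elim_inl, Sum.elim_inr]
      have ht' : ∑ x, t (Sum.inl x) • u x + ∑ y, t (Sum.inr y) • v y = 0 := by
        simpa only [Fintype.sum_sum_type, Sum.elim_inl, Sum.elim_inr] using ht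
      have h := htransfer j hj _ _ ht'
      simp only [hBM j hj] at h
      exact h
  /- quadratic rigidity on each good `κ_j`: `{A_{x₁}, A_{x₂}} κ_j = 2⟨u_{x₁},u_{x₂}⟩ κ_j` -/
  have hw1 : ∀ i, ‖Sum.elim u v i‖ = 1 := by
    obtain ⟨hu1, hv1⟩ := norm_eq_one_of_isCSystem hn hm hC huv
    intro i; cases i with
    | inl x => exact hu1 x
    | inr y => exact hv1 y
  have hTκ : ∀ j, 0 < lam j →
      (A x₁ * A x₂ + A x₂ * A x₁) *ᵥ κ j = (2 * inner ℝ (u x₁) (u x₂)) • κ j := by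
    intro j hj
    -- enough: against every test vector `η`
    suffices hD : ∀ η : σ → ℂ, (star η ⬝ᵥ ((A x₁ * A x₂ + A x₂ * A x₁) *ᵥ κ j)).re =
        2 * inner ℝ (u x₁) (u x₂) * (star η ⬝ᵥ κ j).re by
      set z := (A x₁ * A x₂ + A x₂ * A x₁) *ᵥ κ j - (2 * inner ℝ (u x₁) (u x₂)) • κ j with hz
      have hz0 : (star z ⬝ᵥ z).re = 0 := by
        have h := hD z
        rw [hz, dotProduct_sub, Complex.sub_re, dotProduct_smul, Complex.smul_re, smul_eq_mul, ← hz, h,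
          sub_self]
      have hRz : realify σ z = 0 := by
        have h := norm_realify_sq z
        rw [hz0] at h
        exact norm_eq_zero.mp (pow_eq_zero_iff two_ne_zero |>.mp h)
      exact sub_eq_zero.mp (eq_zero_of_realify_eq_zero hRz)
    intro η
    -- the test functional
    let φ : Matrix σ σ ℂ →ₗ[ℝ] ℝ :=
      { toFun := fun X => (star η ⬝ᵥ (X *ᵥ κ j)).re
        map_add' := fun X Y => by
          simp only [Matrix.add_mulVec, dotProduct_add, Complex.add_re]
        map_smul' := fun c X => by
          simp only [Matrix.smul_mulVec, dotProduct_smul, Complex.smul_re, RingHom.id_apply,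
            smul_eq_mul] }
    have hφ : ∀ X, φ X = (star η ⬝ᵥ (X *ᵥ κ j)).re := fun X => rfl
    let G : Matrix (Fin n ⊕ Fin m) (Fin n ⊕ Fin m) ℝ :=
      Matrix.of fun i i' => inner ℝ (Sum.elim u v i) (Sum.elim u v i')
    let D : Matrix (Fin n ⊕ Fin m) (Fin n ⊕ Fin m) ℝ :=
      Matrix.of fun i i' => φ (W i * W i' + W i' * W i) / 2 - G i i' * φ 1
    have hDsymm : Dᵀ = D := by
      ext i i'
      simp only [D, G, Matrix.transpose_apply, Matrix.of_apply]
      rw [add_comm (W i' * W i), real_inner_comm]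
    have hDdiag : ∀ i, D i i = 0 := fun i => by
      simp only [D, G, Matrix.of_apply, real_inner_self_eq_norm_sq, hw1 i, one_pow, one_mul]
      rw [hφ, hφ, Matrix.add_mulVec, ← Matrix.mulVec_mulVec, hWW j hj i, Matrix.one_mulVec,
        dotProduct_add, Complex.add_re]
      ring
    have hDker : ∀ t : Fin n ⊕ Fin m → ℝ, ∑ i, t i • Sum.elim u v i = 0 → D *ᵥ t = 0 := by
      intro t ht
      have hWt0 := hWt t ht
      funext i
      rw [Pi.zero_apply, Matrix.mulVec, dotProduct]
      simp only [D, Matrix.of_apply, sub_mul, Finset.sum_sub_distrib]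
      have h1 : ∑ i', φ (W i * W i' + W i' * W i) / 2 * t i' =
          φ (∑ i', t i' • (W i * W i' + W i' * W i)) / 2 := by
        rw [map_sum, Finset.sum_div]
        refine Finset.sum_congr rfl fun i' _ => ?_
        rw [map_smul, smul_eq_mul]; ring
      have h2 : ∑ i', t i' • (W i * W i' + W i' * W i) = W i * (∑ i', t i' • W i') +
          (∑ i', t i' • W i') * W i := by
        rw [Finset.mul_sum, Finset.sum_mul, ← Finset.sum_add_distrib]
        refine Finset.sum_congr rfl fun i' _ => ?_
        rw [smul_add, mul_smul_comm, smul_mul_assoc]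
      have h3 : ∑ i', G i i' * φ 1 * t i' = inner ℝ (Sum.elim u v i) (∑ i', t i' • Sum.elim u v i') * φ 1 := by
        rw [inner_sum, Finset.sum_mul]
        refine Finset.sum_congr rfl fun i' _ => ?_
        simp only [G, Matrix.of_apply, real_inner_smul_right]
        ring
      rw [h1, h2, hWt0, Matrix.mul_zero, Matrix.zero_mul, add_zero, map_zero, zero_div, h3, ht,
        inner_zero_right, zero_mul, sub_zero]
    have hD0 := gram_perturbation_eq_zero hn hm hC huv D hDsymm hDdiag hDker
    have h12 := congrFun (congrFun hD0 (Sum.inl x₁)) (Sum.inl x₂)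
    simp only [D, G, W, Matrix.of_apply, Sum.elim_inl, Matrix.zero_apply] at h12
    rw [hφ, hφ, Matrix.one_mulVec] at h12
    linarith
  /- conclusion: `T = {A_{x₁},A_{x₂}} − 2g I` commutes with every `B_y` and kills every good `κ_j` -/
  have hT := hkill (A x₁ * A x₂ + A x₂ * A x₁ - ((2 * inner ℝ (u x₁) (u x₂) : ℝ) : ℂ) • 1)
    (fun y => by
      rw [Matrix.sub_mul, Matrix.mul_sub, Matrix.add_mul, Matrix.mul_add, Matrix.smul_mul,
        Matrix.mul_smul, Matrix.one_mul, Matrix.mul_one, Matrix.mul_assoc, hcomm x₂,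
        ← Matrix.mul_assoc, hcomm x₁, Matrix.mul_assoc, Matrix.mul_assoc, hcomm x₁,
        ← Matrix.mul_assoc (A x₂), hcomm x₂, Matrix.mul_assoc])
    (fun j hj => by
      rw [Matrix.sub_mulVec, hTκ j hj, Matrix.smul_mulVec, Matrix.one_mulVec,
        ← Complex.coe_smul, sub_self])
  exact sub_eq_zero.mp hT

/-! #### B5. Discharge of `Tsirelson1987_thm20` -/

/-- **Discharge of `Tsirelson1987_thm20`** (PSVW Theorem 20 = [TS87]): the `A`-side is
`anticommutator_eq_of_extreme`; the `B`-side is the same statement for the transposed data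
`(m, n, Cᵀ, B, A, ρ, v, u)` (condition (v) is symmetric in the two families, `Cᵀ` is extreme, and
`Tr(B_yA_xρ) = Tr(A_xB_yρ)` by commutation). The proof is an independent elementary argument (the
original [Tsirelson1987] is not held): Gram rigidity of `C`-systems of an extreme `C` (from Lemma 12
by direct sums), a Li–Tam-type quadratic rigidity of their Gram matrix run inside `Cor(n,m)`, the
pure components of `ρ` as `C`-systems, and cyclicity of the support under the `B`-algebra.
[cite: PrakashEtAl2017, Thm. 20 (p24), after Tsirelson1987] -/
theorem Tsirelson1987_thm20_holds : Tsirelson1987_thm20 := by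
  intro n m σ _ _ C hn hm hC A B ρ hCtr hcomm hρ hρ1 hA hB hirr N u v huv
  refine ⟨fun x x' => anticommutator_eq_of_extreme hn hm hC A B ρ hCtr hcomm hρ hρ1 hA hB hirr huv
    x x', fun y y' => ?_⟩
  have hCt : Cᵀ ∈ Set.extremePoints ℝ (quantumCorrelations m n) :=
    transpose_mem_extremePoints_quantumCorrelations hC
  have hCtr' : ∀ y x, ((Cᵀ y x : ℝ) : ℂ) = (B y * A x * ρ).trace := fun y x => by
    rw [Matrix.transpose_apply, hCtr, hcomm]
  have hcomm' : ∀ y x, B y * A x = A x * B y := fun y x => (hcomm x y).symm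
  have hirr' : ¬ ∃ P : Matrix σ σ ℂ, P.IsHermitian ∧ P * P = P ∧ P ≠ 1 ∧
      (∀ y, P * B y = B y * P) ∧ (∀ x, P * A x = A x * P) ∧ P * ρ * P = ρ := by
    rintro ⟨P, h1, h2, h3, h4, h5, h6⟩
    exact hirr ⟨P, h1, h2, h3, h5, h4, h6⟩
  exact anticommutator_eq_of_extreme hm hn hCt B A ρ hCtr' hcomm' hρ hρ1 hB hA hirr' huv.transpose
    y y'

/-- **PSVW Theorem 10 (i)⇒(iii) in commuting form = GdLL Theorem 4.1 (4)⇒(1) [Tsirelson]** (PSVW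
p17; GdLL p13: "Suppose `({X_s}, {Y_t}, W)` is a commuting operator representation of `C` … So, with
`x_s = ⊕_i √λ_i (Re(X_sψ_i), Im(X_sψ_i))` and `y_t = ⊕_i √λ_i (Re(Y_tψ_i), Im(Y_tψ_i))` we have
`C_{s,t} = ⟨x_s, y_t⟩` and `‖x_s‖, ‖y_t‖ ≤ 1`, and … we can extend the vectors `x_s` and `y_t` to unit
vectors"): Hermitian contractions `A_x, B_y` on `ℂ^σ` and a state `ρ` with `c_{xy} = Tr(A_xB_yρ)`
force `C ∈ Cor(n,m)`. Proved with the machinery of Theorem 20's proof above: `C = Σ_j λ_j C_j` over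
the spectral decomposition of `ρ`, each pure component `C_j` has the `C`-system
`(R(A_xκ_j), R(B_yκ_j))` of sub-unit vectors (hence lies in `Cor(n,m)` by padding), and `Cor(n,m)` is
convex. (Commutation `A_xB_y = B_yA_x` is part of the printed hypothesis but is not used for this
direction.) [cite: PrakashEtAl2017, Thm. 10 (p17); GriblingDelaatLaurent2017, Thm. 4.1 (4)⇒(1) (p13)] -/
theorem mem_quantumCorrelations_of_commutingRep {C : Matrix (Fin n) (Fin m) ℝ}
    (A : Fin n → Matrix σ σ ℂ) (B : Fin m → Matrix σ σ ℂ) (ρ : Matrix σ σ ℂ)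
    (hCtr : ∀ x y, ((C x y : ℝ) : ℂ) = (A x * B y * ρ).trace)
    (hρ : ρ.PosSemidef) (hρ1 : ρ.trace = 1)
    (hA : ∀ x, (A x).IsHermitian ∧ (1 - A x).PosSemidef ∧ (1 + A x).PosSemidef)
    (hB : ∀ y, (B y).IsHermitian ∧ (1 - B y).PosSemidef ∧ (1 + B y).PosSemidef) :
    C ∈ quantumCorrelations n m := by
  classical
  obtain ⟨κ, hκ1, htr, -⟩ := spectral_data hρ.1
  set lam : σ → ℝ := hρ.1.eigenvalues with hlam
  have hlam0 : ∀ j, 0 ≤ lam j := fun j => hρ.eigenvalues_nonneg j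
  have hlam1 : ∑ j, lam j = 1 := by
    have h := hρ.1.trace_eq_sum_eigenvalues
    rw [hρ1] at h
    have h2 : ((∑ j, lam j : ℝ) : ℂ) = 1 := by rw [Complex.ofReal_sum]; exact h.symm
    exact_mod_cast h2
  let Cp : σ → Matrix (Fin n) (Fin m) ℝ := fun j =>
    Matrix.of fun x y => (star (A x *ᵥ κ j) ⬝ᵥ (B y *ᵥ κ j)).re
  have hsys : ∀ j, IsCSystem (Cp j) (fun x => realify σ (A x *ᵥ κ j))
      (fun y => realify σ (B y *ᵥ κ j)) := by
    intro j
    refine ⟨fun x => ?_, fun y => ?_, fun x y => by rw [inner_realify]; rfl⟩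
    · have h2 : ‖realify σ (A x *ᵥ κ j)‖ ^ 2 ≤ 1 := by
        rw [norm_realify_sq]
        have := re_star_mulVec_dotProduct_mulVec_le (hA x).1 (hA x).2.1 (hA x).2.2 (κ j)
        rwa [hκ1 j, Complex.one_re] at this
      nlinarith [norm_nonneg (realify σ (A x *ᵥ κ j))]
    · have h2 : ‖realify σ (B y *ᵥ κ j)‖ ^ 2 ≤ 1 := by
        rw [norm_realify_sq]
        have := re_star_mulVec_dotProduct_mulVec_le (hB y).1 (hB y).2.1 (hB y).2.2 (κ j)
        rwa [hκ1 j, Complex.one_re] at this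
      nlinarith [norm_nonneg (realify σ (B y *ᵥ κ j))]
  have hCp : ∀ j, Cp j ∈ quantumCorrelations n m := fun j =>
    mem_quantumCorrelations_of_isCSystem (hsys j)
  have hdec : ∑ j, lam j • Cp j = C := by
    ext x y
    have h := congrArg Complex.re (hCtr x y)
    rw [Complex.ofReal_re, htr (A x * B y), Complex.re_sum] at h
    rw [h, Matrix.sum_apply]
    refine Finset.sum_congr rfl fun j _ => ?_
    rw [Matrix.smul_apply, smul_eq_mul, Complex.re_ofReal_mul]
    congr 1
    simp only [Cp, Matrix.of_apply]
    rw [Matrix.star_mulVec, ← Matrix.dotProduct_mulVec, Matrix.mulVec_mulVec, (hA x).1.eq]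
  rw [← hdec]
  exact convex_quantumCorrelations.sum_mem (fun j _ => hlam0 j) hlam1 fun j _ => hCp j

/-- Public form of the padding lemma used throughout (a `C`-system of SUB-unit vectors in any `ℝ^N`
shows `C ∈ Cor(n,m)`; PSVW p24 / GdLL p08 "observation" in the proof of Lemma 3.2).
[cite: GriblingDelaatLaurent2017, proof of Lemma 3.2 (p08); PrakashEtAl2017, Def. 5 (p24)] -/
theorem IsCSystem.mem_quantumCorrelations {N : ℕ} {C : Matrix (Fin n) (Fin m) ℝ}
    {u : Fin n → EuclideanSpace ℝ (Fin N)} {v : Fin m → EuclideanSpace ℝ (Fin N)}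
    (h : IsCSystem C u v) : C ∈ quantumCorrelations n m :=
  mem_quantumCorrelations_of_isCSystem h

end Operator

end Thm20Proof

/-! ### Uniqueness of the extension of an extreme correlation (GdLL Lemma 3.2 (ii)), public form (appended) -/

section ExtensionUniqueness

variable {n m : ℕ}

/-- **Uniqueness of the extension of an extreme bipartite correlation** (GdLL Lemma 3.2 (ii), p08,
after [Tsirelson:87], verbatim: "Assume `C` is an extreme point of `Cor(m,n)`. … (ii) The matrix `C`
has a unique extension to a matrix `E ∈ 𝓔_{m+n}`, and there exists a `C`-system
`x_1,…,x_m,y_1,…,y_n ∈ ℝ^r`, with `r = rank(C)`, such that `E = Gram(x_1,…,x_m,y_1,…,y_n)`"; GdLL's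
proof, p08: "`⟨x'_r, x'_s⟩ = ⟨x''_r, x''_s⟩` for all `r,s ∈ S` … This shows `C` has a unique extension"),
the uniqueness clause in `C`-system language: for an extreme `C` (`n, m ≥ 1`, the standing Bell-scenario
assumption) any two `C`-systems `(u, v) ⊂ ℝ^N`, `(u', v') ⊂ ℝ^{N'}` (sub-unit vectors, PSVW Def. 5)
have the same Gram matrix `Gram(u ⊔ v) = Gram(u' ⊔ v')` — so every extension of `C` in the elliptope
is this one Gram matrix. Public export of the in-file step `inner_elim_eq_of_isCSystem` of the proof
of PSVW Lemma 12 (direct-sum trick). The existence clause with `r = rank C` is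
`finrank_span_eq_rank_of_mem_extremePoints`. [cite: GriblingDelaatLaurent2017, Lemma 3.2 (ii) (p08)] -/
theorem gram_sumElim_eq_of_mem_extremePoints {N N' : ℕ} {C : Matrix (Fin n) (Fin m) ℝ} (hn : 0 < n)
    (hm : 0 < m) (hC : C ∈ Set.extremePoints ℝ (quantumCorrelations n m))
    {u : Fin n → EuclideanSpace ℝ (Fin N)} {v : Fin m → EuclideanSpace ℝ (Fin N)}
    {u' : Fin n → EuclideanSpace ℝ (Fin N')} {v' : Fin m → EuclideanSpace ℝ (Fin N')}
    (h : IsCSystem C u v) (h' : IsCSystem C u' v') :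
    Matrix.gram ℝ (Sum.elim u v) = Matrix.gram ℝ (Sum.elim u' v') :=
  Matrix.ext fun i j => by
    rw [Matrix.gram_apply, Matrix.gram_apply]
    exact inner_elim_eq_of_isCSystem hn hm hC h h' i j

end ExtensionUniqueness

end Literature.Combinatorics.Optimization
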